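import Mathlib

/-!
# `Balaban1983to89.B8` — T. Balaban, *Spaces of regular gauge field configurations on a lattice and gauge
fixing conditions*, Commun. Math. Phys. **99**, 75–102 (1985).  (INDEX: B8; refs: [1] = Harvard
preprint HUTMP B134 (UNPUBLISHED — never cited here, GAPS G-B8-01), [2] = B5/B6, [3] = B7, [4] = B9.)
PDF held: `paper:balaban1985-cmp99-regular-spaces-gauge-fixing` (journal page = PDF page + 74).

statement-level skeleton of published theorems with citation tags; proofs where landed; nothing here is a claim
about the Yang–Mills mass gap
(lit-balaban framing line; added on page 1 by r05 gen 3, 2026-08-21, DOCSTRING-ONLY — no declaration touched.)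

CITATION HEADER (lean-in-tree rule 2026-08-18). This module is a TYPED SKELETON (statement level) of the published paper
T. Bałaban, "Spaces of regular gauge field configurations on a lattice and gauge fixing conditions", *Comm. Math. Phys.* **99**, 75–102 (1985) [Balaban1985RegularSpaces] (cell paper B8).
WHAT IS REPRODUCED: the main theorems/propositions as `def … : Prop` carrying the VERBATIM printed statement in the docstring
(journal page + equation numbers), over abstract carrier structures whose Prop-valued fields name the printed hypotheses; plus a few
kernel-checked pieces of elementary arithmetic re-deriving printed constants (the audit's "second engine").  NOTHING of the series is
asserted: the series' end-statement (ultraviolet stability of 4-d lattice gauge theories, [Balaban1987RG1] Thm 2 ff.) is a CLAIM UNDER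
ADJUDICATION by the audit cell `pub-balaban`; every `…Printed` Prop here is consumed downstream only as a hypothesis `(h : …Printed …)`.
The cell's line-by-line census of this paper (objections located to page/equation, certifications) is the cell's GAPS.md (ids quoted in
the docstrings: C-… certified, G-… objection/flag, D-… divergence row of the cell's DIVERGENCE.md).  Why local carrier structures and not
the shared `Setup` vocabulary (`…Balaban1983to89.Setup`): this paper's statements quantify over operator KERNELS and norm functionals
(random-walk expansions, Hölder norms, weighted sup norms, quadratic forms) that `Setup` deliberately does not model; the carriers only
NAME those functionals as fields, so no `Setup` definition is restated here and nothing is defined twice.  Staged byte-identically in the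
cell package `run/shared/lean/pub/pub-balaban/lean/BalabanYm4/Literature/MathematicalPhysics/QuantumFieldTheory/Balaban1983to89/B8.lean`
(legacy copy `BalabanYm4/B8.lean` there, namespace `BalabanYm4.B8`, same declarations).

Unit `b2b-balaban-r1` (reader group A).  STATEMENT LEVEL ONLY: Lemma 1 (p. 79), Theorem 2 (p. 83),
Proposition 3 (p. 87), Theorem 4 (p. 88), Proposition 5 (p. 94), Proposition 6 (p. 99), Proposition 7
(p. 100), Theorem 8 (p. 101), each quoted VERBATIM in its docstring, hypotheses (1.33)–(1.35) etc. as
explicit predicates of an abstract carrier, constants chosen before the instance ("depend on d and L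
only").  FORWARD DEPENDENCY (DIVERGENCE/GAPS G-B8-06/07): B8 USES B9 = [4] (Thms 3.1–3.3, (3.35),
(3.47)); the B9 inputs appear below as the named hypothesis records `B9Inputs`.  NOT TYPED, on purpose:
the Hölder variant (1.147) p. 101 — declared but NOT proved in print and not used (GAPS G-B8-09); it must
never be cited.  KERNEL-CHECKED: the arithmetic certified by hand in census C-B8-1 ((1.65), (1.72), the
contraction constants of Sect. D–E).  Companion prose: `HOME/b2b-balaban-r1/B8.md`; census rows C-B8-*,
G-B8-* in `HOME/GAPS.md`.

NORM: B8 uses the operator norm |X| of B7 (19); B9 the normalised Hilbert–Schmidt norm (DIVERGENCE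
D-r1.1) — every `B9Inputs` field is to be read with the conversion factor c_N ∈ [1, √N].

PHASE 2 (paper sub-cell B08, unit `b2b-balaban-b08`, 2026-08-18): the section `## Phase 2` below adds the full
Proposition 3 (`GFData2`, `Prop3Printed`), the kernel-checked a-priori algebra of Sect. C (`apriori_160`,
`apriori_162`), the printed proof structures Thm 4 + Prop 3 + (1.65) ⇒ Thm 2 (`thm2_of_thm4_prop3`, with the
explicit schedule `thm2_schedule_exists`) and Thm 4 by induction on k (`Thm4Skeleton.thm4_all`), the Sect. F
arithmetic (`ineq130_iff`, `prop6_smallness_iff`), the constant of (1.37) (`ineq137`), the ring identities behind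
(1.49)–(1.50) and (1.93)–(1.95) (`v2_identity`, `commutators_150`, `landau_projection_identities`), the sub-cell's
inspection of Theorem 8 (`Thm8Inspected`, census G-B8-13) and the bundled leaf `Concl`; the collar margin of
Sect. F (`sectF_collar_margin`, census G-B8-15).  Census rows of this pass: G-B8-10 … G-B8-15 (G-B8-15 raised
and resolved), C-B8-7 … C-B8-13 in the cell's GAPS.md.

REVISION v3 (paper sub-cell B08 gen 3, unit `b2b-balaban-b08`, 2026-08-18) — DOCSTRING-ONLY, no declaration line
changed: (a) cell GAPS G-pv17-2 (cross-read pv17, render p. 101 [PDF 27]): the docstring of `Thm8Inspected` presented a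
paraphrase of the printed proof sentence of Theorem 8 in quotation italics; it now quotes p. 100 l. −1 – p. 101 ll. 1–9
verbatim; (b) cell DIVERGENCE D-pv14.6 (cross-read pv14, renders pp. 86–87 [PDF 12–13]): the lead-in of `Prop3Body`'s
docstring merged p. 86 "Now we assume further that" and p. 87 "Let us formulate the results in" into one pseudo-quotation
and placed (1.61) on p. 87; the two printed sentences are now quoted separately and (1.61) is located on p. 86.  The typed
hypothesis `h61`-clause of `Prop3Body` (= the display (1.61)) and every other statement are unaffected.
REVISION v3.1 (reader group A gen 4, unit `b2b-balaban-r1-g4`, 2026-08-18) — DOCSTRING-ONLY, no declaration line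
changed: REFEREE R22.1 / R25.3 residual of cell GAPS G-ref1-8 — the docstring of the bundled leaf `Concl` (§(vii)) now
says that, as the DAG's B8 leaf, it is SUPERSEDED by `DagBinding.B8LeafR` / `Upstream.ofPrintedR` / `Upstream.ofPrintedFull`
(faithful forms `B8SectGH.Prop7PrintedR`, `B8SectGH.Thm8PrintedAt 1`), the r1 typed forms `Prop7Printed`/`Thm8Printed`
being STRONGER than print; former binding recorded in the cell's DIVERGENCE.md (row D-r1g4.1).
REVISION v3.2 (paper sub-cell B08 gen 6, 2026-08-18) — DOCSTRING-ONLY: census G-adv8-11 recorded in the docstring of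
`Prop3Body` (boundary layer of Ω_j; the printed B₁ = 5dLB₀ typed as printed).
REVISION v4 (paper sub-cell B08 gen 7, unit `b2b-balaban-b08-g7`, 2026-08-18) — APPEND-ONLY, no existing declaration
line changed (one sentence added to the docstring of `LandauData`): new section `### (iii-c)` = the sub-cell's owner
response to cell GAPS G-adv8-13 (hostile reading adv8-g12: the uniqueness paragraph of Theorem 4, p. 95, applies
Proposition 5 to u₁ := a level-k solution, which satisfies (1.29)_k and not Prop. 5's printed hypothesis (1.68);
repair = read Prop. 5 with (1.29)_k — v4 wrote here "which is all pp. 90–94 use"; corrected in REVISION v5 below,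
census G-A23-1).  Adds the refined induction skeleton `Thm4SkeletonR`
(Prop.-5 leaf split by hypothesis form; the Phase-2 `Thm4Skeleton` is its coarsening), the carrier-level derivation
of Theorem 4's uniqueness clause from the REPAIRED Prop. 5 (`GaugeCalc`, `Prop5UniqueR`, `thm4Unique_of_prop5R`,
`thm4Printed_of_halves`), the printed-hypothesis variant `Prop5UniquePrinted68` with the exact converse it would need
(`prop5UniqueR_of_printed68`) and a decidable shape-level witness that this converse fails (`toy_129_not_68`).
Census rows: G-adv8-13 (adv8-g12), C-B8-27 (this pass) in the cell's GAPS.md; DIVERGENCE D-b08-g7.1.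
REVISION v5 (paper sub-cell B08 gen 8, unit `b2b-balaban-b08-g8`, 2026-08-18) — DOCSTRING FIXES in § (iii-c) and the
`LandauData` docstring + APPEND-ONLY new section `### (iii-d)`; no existing declaration line changed.  Owner response
to the cell's hostile cross-read of § (iii-c) (GAPS C-A23-1, objection G-A23-1, adv1-g18): v4's prose claims "(1.78),
i.e. (1.29)_k for u₁, is all that Sects. D–E use of (1.68)" and "No display and no constant of the paper changes"
were FALSE AS STATED — Sect. D (p. 89) also feeds Proposition 10 of [3] with u₁'s regularity (166)/(167) of [3] on
B^j(Λ_j) for every j ≤ k, and on the Λ_k region that regularity comes, for the inductive u₁, from (1.68)'s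
B(Λ_k)-clause (the convention "we take Λ_{k−1} ∪ B(Λ_k) as Λ_{k−1}" of (1.74), p. 89); for a level-k solution u₁
(the p. 95 application) it is the unprinted level-k re-run of (1.70)–(1.74), which the paper leaves inside "This
follows from Proposition 8 of [3]".  The kernel statements of v4 are unaffected (the binder `hReg` of
`thm4Unique_of_prop5R` already had the level-k shape); v5 corrects the prose, reads `GaugeCalc.Reg7374` explicitly
as the LEVEL-k form, and § (iii-d) adds the level-indexed calculus `GaugeCalcL` (printed-range predicate `RegPr`,
the law `lev_of_68` by which (1.68) re-enters), the fully printed variant `Prop5UniquePrintedPr`, the named re-run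
`Rerun7074AtK` and the skeleton `Thm4SkeletonL` carrying it as a leaf.  Census rows: G-A23-1 / C-A23-1 (adv1-g18),
C-B8-29 (this pass); DIVERGENCE D-b08-g8.1 (amends D-b08-g7.1 (a)).
-/

namespace Literature.MathematicalPhysics.QuantumFieldTheory.Balaban1983to89.B8

/-- Abstract carrier of the gauge-fixing problem of B8 for a fixed geometric datum
(k; Ω₀ ⊃ Ω₁ ⊃ … ⊃ Ω_k; Λ_j; 𝔅_k) on the η = L^{−k} lattice, fixed d, L and gauge group:
* `bg` = background configurations U₀; `InA α₀ U` = U ∈ 𝔄_k({Ω_j}, α₀) ((1.7)/(1.33): |U(∂p) − 1| <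
  α₀η²(L^jη)^{−2}-type small-field conditions on Ω_j); `Reg335 α₀ U₀` = "U₀ satisfies the regularity
  condition (3.35) in [4]" (second half of (1.33); removed by Prop. 6);
* `pert` = the configurations U′ (so that U′U₀ is the field); `InAAx α₀ U₀ U′` = (1.34): U′U₀ ∈
  𝔄_k({Ω_j}, α₀) ∩ Ax_k(𝔅_k, U₀); `avgClose α₁ U₀ U′` = (1.35): |(U′U₀‾)^j − Ū₀^j| < α₁ on Λ_j, j = 0…k;
  `avgClose166 α₁ U₀ U′` = (1.66): |Ũ′^j − 1| < α₁ on Ω^{(j)}_j;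
* `GT` = gauge transformations; `Restricted u` = (1.29): (R₀u‾^j)(y) = 1, y ∈ Λ_j; `act U′ u` = U′^{u⁻¹};
* the conclusions for U₁ = U′^{u⁻¹} = e^{iηA}: `C136 B₁ B₂ s U₁` = (1.36) with smallness s = α₀ + α₁
  (|A| < B₁s(L^jη)^{−1}, |∇^η_{U₀}A| < B₁s(L^jη)^{−2}, ‖A‖_{1,β} < B₂(β₀)s(L^jη)^{−2−β} on Ω_j, and
  Q_j(U₀, ηA) = B on Λ_j); `C137 α₁ U₁` = (1.37) |B| < 2dLα₁; `Landau U₀ U₁` = (1.38)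
  R(U₀)D^{η*}_{U₀}A = 0; `C139 B₁ s U₁` = (1.39) |D^{η*}_{U₀}D^η_{U₀}A|, |Δ^η_{U₀}A| < B₁s(L^jη)^{−3};
  `C162 B₁' s U₁` = (1.62): |A| < B′₁s(L^jη)^{−1} only; `LandauF U₀ f U₁` = (1.146) R(U₀)D^{η*}_{U₀}A = f
  with `fNorm f` = |f|_{(−2)}. [cite: Balaban1985RegularSpaces, (1.29) + (1.33)–(1.39) pp.81–84] -/
structure GFData where
  Cfg : Type
  Pert : Type
  GT : Type
  Src : Type
  k : ℕ
  InA : ℝ → Cfg → Prop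
  Reg335 : ℝ → Cfg → Prop
  InAAx : ℝ → Cfg → Pert → Prop
  avgClose : ℝ → Cfg → Pert → Prop
  avgClose166 : ℝ → Cfg → Pert → Prop
  Restricted : Cfg → GT → Prop
  act : Pert → GT → Pert
  C136 : ℝ → ℝ → ℝ → Cfg → Pert → Prop
  C137 : ℝ → Cfg → Pert → Prop
  Landau : Cfg → Pert → Prop
  C139 : ℝ → ℝ → Cfg → Pert → Prop
  C162 : ℝ → ℝ → Cfg → Pert → Prop
  fNorm : Src → ℝ
  LandauF : Cfg → Src → Pert → Prop

variable {I : Type}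

/-- **Theorem 2** (p. 83 [PDF 9], verbatim): *"There exist constants B₁, B₂(β₀), c₁ such that for arbitrary
U₀, U′U₀ satisfying (1.33)–(1.35) with α₀ + α₁ ≤ c₁ there exists exactly one gauge transformation u
satisfying (1.29) and such that the conditions (1.36)–(1.39) hold for the configuration U₁ = U′^{u⁻¹}."*
("the constants B₁, B₂(β₀) … are absolute constants depending on d and L only, B₂(β₀) on β₀ also" —
β₀ < 1 fixed here; family index `I` = geometric data for fixed d, L.)  "Exactly one" typed as
∃ u ∧ ∀ u′ with the same properties, u′ = u.  The uniqueness clause rests on Prop. 5's, whose proof has the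
unwritten surjectivity step GAPS G-B8-05. [cite: Balaban1985RegularSpaces, Thm 2 (1.36)–(1.39) p.83] -/
def Thm2Printed (fam : I → GFData) : Prop :=
  ∃ B₁ B₂ c₁ : ℝ, 0 < B₁ ∧ 0 < B₂ ∧ 0 < c₁ ∧
    ∀ i : I, ∀ α₀ α₁ : ℝ, 0 < α₀ → 0 < α₁ → α₀ + α₁ ≤ c₁ →
      ∀ U₀ : (fam i).Cfg, ∀ U' : (fam i).Pert,
        (fam i).InA α₀ U₀ → (fam i).Reg335 α₀ U₀ → (fam i).InAAx α₀ U₀ U' → (fam i).avgClose α₁ U₀ U' →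
          ∃ u : (fam i).GT, (fam i).Restricted U₀ u ∧
            ((fam i).C136 B₁ B₂ (α₀ + α₁) U₀ ((fam i).act U' u) ∧ (fam i).C137 α₁ U₀ ((fam i).act U' u) ∧
              (fam i).Landau U₀ ((fam i).act U' u) ∧ (fam i).C139 B₁ (α₀ + α₁) U₀ ((fam i).act U' u)) ∧
            ∀ u' : (fam i).GT, (fam i).Restricted U₀ u' →
              (fam i).C136 B₁ B₂ (α₀ + α₁) U₀ ((fam i).act U' u') → (fam i).C137 α₁ U₀ ((fam i).act U' u') →
              (fam i).Landau U₀ ((fam i).act U' u') → (fam i).C139 B₁ (α₀ + α₁) U₀ ((fam i).act U' u') →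
                u' = u

/-- **Theorem 4** (p. 88 [PDF 14], verbatim): *"There exists a constant c₁ such that for arbitrary U₀, U′U₀
satisfying (1.33), (1.34), (1.66) with α₀ + α₁ ≤ c₁ there exists exactly one gauge transformation u
satisfying (1.29) and such that the conditions (1.37), (1.38), (1.62) hold for the configuration
U₁ = U′^{u⁻¹}."*  ((1.62)/(1.67): |A| < B′₁(α₀ + α₁)(L^jη)^{−1}; print slip G-B8-02: B′₁ = 5dLC′₁B₀.)
Thm 4 ⇒ Thm 2 via Prop. 3 and (1.65). [cite: Balaban1985RegularSpaces, Thm 4 (1.67) p.88] -/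
def Thm4Printed (B₁' : ℝ) (fam : I → GFData) : Prop :=
  ∃ c₁ : ℝ, 0 < c₁ ∧
    ∀ i : I, ∀ α₀ α₁ : ℝ, 0 < α₀ → 0 < α₁ → α₀ + α₁ ≤ c₁ →
      ∀ U₀ : (fam i).Cfg, ∀ U' : (fam i).Pert,
        (fam i).InA α₀ U₀ → (fam i).Reg335 α₀ U₀ → (fam i).InAAx α₀ U₀ U' → (fam i).avgClose166 α₁ U₀ U' →
          ∃ u : (fam i).GT, (fam i).Restricted U₀ u ∧
            ((fam i).C137 α₁ U₀ ((fam i).act U' u) ∧ (fam i).Landau U₀ ((fam i).act U' u) ∧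
              (fam i).C162 B₁' (α₀ + α₁) U₀ ((fam i).act U' u)) ∧
            ∀ u' : (fam i).GT, (fam i).Restricted U₀ u' →
              (fam i).C137 α₁ U₀ ((fam i).act U' u') → (fam i).Landau U₀ ((fam i).act U' u') →
              (fam i).C162 B₁' (α₀ + α₁) U₀ ((fam i).act U' u') → u' = u

/-- The inputs B8 takes from B9 = [4] (GAPS G-B8-03/04/06/07, all matched to printed B9 statements):
`B₀` = "the corresponding norms of the operators G(U₀), H(U₀)" (Prop. 3), i.e. the constant of B9 (3.47)
with γ = −3 (⇒ (1.59)) and γ = −2 (⇒ (1.101), Thm 3.1); `B₀'` = the sup bound (1.92) of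
H′ = G′²Q′*(Q′G′²Q′*)^{−1} (from B9 (3.42) + (3.48) + B6 Lemma 2.1) and of R = I − P (from B9 (3.49)). [cite: Balaban1985RegularSpaces, (1.40)–(1.42) + (1.101) pp.87 + 93] -/
structure B9Inputs where
  B₀ : ℝ
  B₀' : ℝ
  B₀_pos : 0 < B₀
  B₀'_pos : 0 < B₀'

/-- **Proposition 3** (p. 87 [PDF 13], verbatim): *"If U₀, U₁U₀ satisfy (1.40)–(1.42) with α₀, α₁, α₂
bounded by a constant depending on d and L only, and α₂ satisfies the additional restriction (1.61), then
U₁ satisfies (1.36)–(1.39) with B₁ = 5dLB₀, B₂(β₀) = 5dLB₀(β₀), where B₀, B₀(β₀) are the corresponding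
norms of the operators G(U₀), H(U₀), and depend on d and L only, B₀(β₀) on β₀ also."*
Typed as the constant bookkeeping it asserts: the Thm-2 constants are 5dL times the B9 constants. [cite: Balaban1985RegularSpaces, Prop. 3 (1.43)–(1.45) p.87] -/
def Prop3Constants (d : ℕ) (L : ℝ) (inp : B9Inputs) (B₀β : ℝ) : ℝ × ℝ :=
  (5 * d * L * inp.B₀, 5 * d * L * B₀β)

/-- Abstract carrier for **Proposition 5** (the nonlinear Landau gauge, Sects. D–E): for U₁ satisfying
(1.69) with the auxiliary u₁ ((1.68), (1.73), (1.74)) one seeks u′ = e^{iλ}; `lamNorm λ` =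
max(|λ|, |Dλ|_{(−1)}); `Solves U₁ λ` = the equations (1.107): RD*(1/(iη)) log U₁^{u′⁻¹} = 0,
R₀u′u₁‾^j = 1 on Λ_j.  (Revision v4, census G-adv8-13: in the uniqueness application p. 95 the auxiliary u₁ is a
level-k solution, which satisfies (1.29)_k — and, by a level-k re-run of (1.70)–(1.74) that the paper does not
print for it (revision v5, census G-A23-1), "(1.73), (1.74) with k instead of k − 1" — but not the inductive
condition (1.68); the intended reading of the u₁-clause of `Hyp169` is therefore the REPAIRED one, "(1.29)_k and
(1.73), (1.74) with k instead of k − 1" — see § (iii-c) `Prop5UniqueR` and § (iii-d); the quotation of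
Proposition 5 below is kept as printed.) [cite: Balaban1985RegularSpaces, (1.68)–(1.74) pp.88–89] -/
structure LandauData where
  Cfg : Type
  Lam : Type
  Hyp169 : ℝ → ℝ → Cfg → Prop
  lamNorm : Lam → ℝ
  Solves : Cfg → Lam → Prop

/-- **Proposition 5** (p. 94 [PDF 20], verbatim): *"There exist positive constants c₂, c₃, depending on d
and L only, such that for an arbitrary configuration U₁ satisfying (1.69), and for the configuration u₁
determined by U₁ and satisfying (1.68), (1.73), (1.74), if α₀ + α₁ ≤ c₂, then there exists a configuration
u′ = e^{iλ} satisfying the equations RD*(1/(iη)) log U₁^{u′⁻¹} = 0, R₀u′u₁‾^j = 1 on Λ_j, j = 0, 1, …, k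
(1.107) and the bounds |λ|, |Dλ|_{(−1)} < 8B′₀B₁(α₀ + α₁). (1.108)  Such a configuration u′ is unique in
the domain |λ|, |Dλ|_{(−1)} < c₃. (1.109)"*  p. 94: "The part … concerning the existence of u′ was proved
completely.  The uniqueness follows from the fact that the image of a set {λ : |λ|, |Dλ|_{(−1)} < ½α₄} by
the transformation λ → λ − H′D′(u₁, λ) contains the set {λ′ : … < ¼α₄} … This follows from results of
the next section."  GAPS G-B8-05: that surjectivity is NOT proved on p. 97 (only smallness + Lipschitz ½
of H′D′); the uniqueness half is typed separately (`Prop5Unique`) so that downstream use can be traced. [cite: Balaban1985RegularSpaces, Prop. 5 (1.108) p.94] -/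
def Prop5Exists (B₀' B₁ : ℝ) (fam : I → LandauData) : Prop :=
  ∃ c₂ : ℝ, 0 < c₂ ∧ ∀ i : I, ∀ α₀ α₁ : ℝ, 0 < α₀ → 0 < α₁ → α₀ + α₁ ≤ c₂ →
    ∀ U₁ : (fam i).Cfg, (fam i).Hyp169 α₀ α₁ U₁ →
      ∃ lam : (fam i).Lam, (fam i).Solves U₁ lam ∧ (fam i).lamNorm lam < 8 * B₀' * B₁ * (α₀ + α₁)

/-- Uniqueness half of Proposition 5 ((1.109) p. 94) — rests on the unwritten surjectivity step G-B8-05. [cite: Balaban1985RegularSpaces, Prop. 5 (1.109) p.94] -/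
def Prop5Unique (fam : I → LandauData) : Prop :=
  ∃ c₂ c₃ : ℝ, 0 < c₂ ∧ 0 < c₃ ∧ ∀ i : I, ∀ α₀ α₁ : ℝ, 0 < α₀ → 0 < α₁ → α₀ + α₁ ≤ c₂ →
    ∀ U₁ : (fam i).Cfg, (fam i).Hyp169 α₀ α₁ U₁ →
      ∀ l₁ l₂ : (fam i).Lam, (fam i).Solves U₁ l₁ → (fam i).Solves U₁ l₂ →
        (fam i).lamNorm l₁ < c₃ → (fam i).lamNorm l₂ < c₃ → l₁ = l₂

/-- C-B8-1, kernel-checked (Sect. D contraction constants, p. 93–94): with β = ¼ in (1.103) and the choice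
α₄ = 8B′₀B₁(α₀ + α₁), the condition 4C′₄B′₀B₁(α₀ + α₁) ≤ ½C′₄α₄ holds (with equality). [folklore] -/
theorem contraction_constant (C₄' B₀' B₁ s : ℝ) :
    4 * C₄' * B₀' * B₁ * s ≤ (1 / 2) * C₄' * (8 * B₀' * B₁ * s) := by
  ring_nf
  rfl

/-- C-B8-3, kernel-checked ((1.65) p. 88): iterating Lemma 1 with B7 Prop. 2 gives the geometric factor
8d²/(1 − L^{−2}) ≤ 32d²/3 for L ≥ 2, and 32d²/3 < 11d² — hence "|Ũ′^j − 1| < 11d²α₀ + α₁". [folklore] -/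
theorem ineq165 (d L : ℝ) (hd : 0 < d) (hL : 2 ≤ L) :
    8 * d ^ 2 / (1 - (L ^ 2)⁻¹) ≤ 32 * d ^ 2 / 3 ∧ 32 * d ^ 2 / 3 < 11 * d ^ 2 := by
  have hL2 : (4 : ℝ) ≤ L ^ 2 := by nlinarith
  have hinv : (L ^ 2)⁻¹ ≤ 1 / 4 := by
    rw [inv_le_comm₀ (by positivity) (by norm_num)]; simpa using hL2
  have hden : (3 : ℝ) / 4 ≤ 1 - (L ^ 2)⁻¹ := by linarith
  refine ⟨?_, by nlinarith [mul_pos hd hd]⟩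
  rw [div_le_iff₀ (by linarith)]
  nlinarith [mul_pos hd hd]

/-- C-B8-4, kernel-checked ((1.72) p. 89): 8d/(1 − L^{−1}) ≤ 16d for L ≥ 2. [folklore] -/
theorem ineq172 (d L : ℝ) (hd : 0 ≤ d) (hL : 2 ≤ L) : 8 * d / (1 - L⁻¹) ≤ 16 * d := by
  have hLpos : 0 < L := by linarith
  have hinv : L⁻¹ ≤ 1 / 2 := by rw [inv_le_comm₀ hLpos (by norm_num)]; simpa using hL
  rw [div_le_iff₀ (by linarith)]
  nlinarith

/-- Abstract carrier for **Lemma 1** (p. 79) and **Proposition 6** (p. 99): one-step / cube-local data. [cite: Balaban1985RegularSpaces, Lemma 1 p.79; Prop. 6 p.99] -/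
structure LocalData where
  Cfg : Type
  Pert : Type
  /-- Lemma 1 hypotheses: V₀, V′V₀ satisfy (1.7) for k = 1 (`small α₀`), (R(V₀)V′)(Γ_{y,x}) = 1 and
  |V′V₀‾ − V̄₀| < α₁ on Ω₁^{(1)} (`axialClose α₁`) -/
  small : ℝ → Cfg → Pert → Prop
  axialClose : ℝ → Cfg → Pert → Prop
  /-- sup over bonds of Ω₁ of |V′ − 1| -/
  pertDev : Pert → ℝ

/-- **Lemma 1** (p. 79 [PDF 5], verbatim): *"Let V₀, V′V₀ satisfy the condition (1.7) for k = 1 and L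
arbitrary, and let (R(V₀)V′)(Γ_{y,x}) = 1 for x ∈ B(y), |V′V₀‾ − V̄₀| < α₁ on Ω₁^{(1)}. (1.24)  Then for α₀, α₁
small the configuration V′ is also small, more precisely we have the bound |V′ − 1| < 4d²α₀ + α₁ on Ω₁.
(1.25)"*  (Proof pp. 79–80 present and elementary, C-B8-1.) [cite: Balaban1985RegularSpaces, Lemma 1 (1.25) p.79] -/
def Lemma1Printed (d : ℕ) (fam : I → LocalData) : Prop :=
  ∃ c : ℝ, 0 < c ∧ ∀ i : I, ∀ α₀ α₁ : ℝ, 0 < α₀ → α₀ ≤ c → 0 < α₁ → α₁ ≤ c →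
    ∀ V₀ : (fam i).Cfg, ∀ V' : (fam i).Pert,
      (fam i).small α₀ V₀ V' → (fam i).axialClose α₁ V₀ V' → (fam i).pertDev V' < 4 * d ^ 2 * α₀ + α₁

/-- Abstract carrier for **Proposition 6** (Sect. F, p. 98–99): U₀ ∈ 𝔄_k (`InA α₀ U₀`), a cube □ of the
class of (3.35) [4] with index j and size parameter M (`idx`, `sizeM`), and the conclusion (1.135)–(1.138):
there is a gauge transformation u on □̃ with U₀^{u⁻¹} = e^{iηA} and the scaled sup norms of A,
∇^ηA, ∂^{η*}∂^ηA, Δ^ηA on □_j bounded by the given number (`GaugedBound U₀ c r`), the averages in the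
axial form (1.137) and R∂^{η*}A = 0 (1.138) (folded into `GaugedBound`). [cite: Balaban1985RegularSpaces, Sect. F pp.98–99] -/
structure CubeData where
  Cfg : Type
  Cube : Type
  idx : Cube → ℕ
  sizeM : Cube → ℝ
  InA : ℝ → Cfg → Prop
  GaugedBound : Cfg → Cube → ℝ → Prop

/-- **Proposition 6** (p. 99 [PDF 25], verbatim): *"Let U₀, U′₀, □, □̃ be as described above, and let
7dL²Mα₀ ≤ c₁.  There exists a gauge transformation u defined on □̃ and such, that U₀^{u⁻¹} = U₁ = e^{iηA}
on □̃, (1.135)  L^jη|A|, (L^jη)²|∇^ηA|, (L^jη)³|∂^{η*}∂^ηA|, (L^jη)³|Δ^ηA| < 7dL²B₁Mα₀ on □_j, (1.136)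
Q_k(ηA) = (1/i) log Ū′₀^k on □^{(k)}, |(1/i) log Ū′₀^k(x, x′)| < |x − y|4α₀ ≤ 2dMα₀ for ⟨x, x′⟩ ⊂ □^{(k)},
y is a center of □, (1.137)  R∂^{η*}A = 0, the operator R is determined by {□_j}. (1.138)  The functions
and derivatives above are defined without any external gauge field configuration (or the configuration is
equal to 1)."*  ⇒ U₀ ∈ 𝔄_k(α₀) satisfies B9's (3.35)–(3.36) with "O(1)Mα₀" = 7dL²B₁Mα₀ (GAPS G-B8-07;
norm conversion D-r1.1). [cite: Balaban1985RegularSpaces, Prop. 6 (1.135)–(1.137) p.99] -/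
def Prop6Printed (d : ℕ) (L B₁ c₁ : ℝ) (fam : I → CubeData) : Prop :=
  ∀ i : I, ∀ α₀ : ℝ, 0 < α₀ → ∀ U₀ : (fam i).Cfg, (fam i).InA α₀ U₀ →
    ∀ c : (fam i).Cube, 7 * d * L ^ 2 * (fam i).sizeM c * α₀ ≤ c₁ →
      (fam i).GaugedBound U₀ c (7 * d * L ^ 2 * B₁ * (fam i).sizeM c * α₀)

/-- **Proposition 7** (p. 100 [PDF 26], verbatim): *"If the configurations U₀, A satisfy (1.139), (1.140),
then for α₀, α₂ sufficiently small we have U′U₀ = (U₁U₀)^u ∈ 𝔄_k({Ω_j}, α₀ + 3α₂) ∩ Ax_k(𝔅_k, U₀), (1.144)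
|(U′U₀‾)^j − Ū₀^j| = |exp iQ_j(U₀, ηA) − 1| < 2α₂ on Ω^{(j)}_j. (1.145)"*  (the converse direction:
from a Landau-gauge small field back to the axial-gauge classes; (1.139): U₀ ∈ 𝔄_k(α₀); (1.140):
|A| < α₂(L^jη)^{−1}, |∇^η_{U₀}A| < α₂(L^jη)^{−2} on Ω_j, U₁ = e^{iηA}.)  Typed over `GFData` with
`SmallA α₂ U₀ U₁` := C162 1 α₂ (the (1.140) bound with constant 1). [cite: Balaban1985RegularSpaces, Prop. 7 (1.144)–(1.145) p.100]
(locator corrected 2026-08-20, lit-balaban r05, SKELETON row B8.Prop7: (1.141)–(1.143) are the preparatory bounds of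
p. 100, the proposition's displays are (1.144)–(1.145); docstring-only.) -/
def Prop7Printed (fam : I → GFData) (toAxial : ∀ i, (fam i).Cfg → (fam i).Pert → (fam i).Pert) : Prop :=
  ∃ c : ℝ, 0 < c ∧ ∀ i : I, ∀ α₀ α₂ : ℝ, 0 < α₀ → α₀ ≤ c → 0 < α₂ → α₂ ≤ c →
    ∀ U₀ : (fam i).Cfg, ∀ U₁ : (fam i).Pert, (fam i).InA α₀ U₀ → (fam i).C162 1 α₂ U₀ U₁ →
      (fam i).InAAx (α₀ + 3 * α₂) U₀ (toAxial i U₀ U₁) ∧ (fam i).avgClose (2 * α₂) U₀ (toAxial i U₀ U₁)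

/-- **Theorem 8** (p. 101 [PDF 27], verbatim): *"There exist constants B₁, B₂(β₀), c₁ such that for
arbitrary U₀, U′U₀ satisfying (1.33)–(1.35) with α₀ + α₁ ≤ c₁, and for an arbitrary function f from the
space R(U₀) satisfying the bound |f|_{(−2)} < γ(α₀ + α₁), there exists exactly one gauge transformation u
satisfying (1.29) and such, that the conditions (1.36), (1.37), (1.39), and (1.146) hold for the
configuration U₁ = U′^{u⁻¹}.  The constants B₁, B₂(β₀) are as in Theorems 2, 4, the constant c₁ depends on
d, L and γ."*  GAPS G-B8-08: proved only by "inspecting the proofs … only some constants change". [cite: Balaban1985RegularSpaces, Thm 8 (1.147) p.101] -/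
def Thm8Printed (B₁ B₂ : ℝ) (fam : I → GFData) : Prop :=
  ∀ γ : ℝ, 0 < γ → ∃ c₁ : ℝ, 0 < c₁ ∧
    ∀ i : I, ∀ α₀ α₁ : ℝ, 0 < α₀ → 0 < α₁ → α₀ + α₁ ≤ c₁ →
      ∀ U₀ : (fam i).Cfg, ∀ U' : (fam i).Pert, ∀ f : (fam i).Src,
        (fam i).InA α₀ U₀ → (fam i).Reg335 α₀ U₀ → (fam i).InAAx α₀ U₀ U' → (fam i).avgClose α₁ U₀ U' →
        (fam i).fNorm f < γ * (α₀ + α₁) →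
          ∃ u : (fam i).GT, (fam i).Restricted U₀ u ∧
            ((fam i).C136 B₁ B₂ (α₀ + α₁) U₀ ((fam i).act U' u) ∧ (fam i).C137 α₁ U₀ ((fam i).act U' u) ∧
              (fam i).C139 B₁ (α₀ + α₁) U₀ ((fam i).act U' u) ∧ (fam i).LandauF U₀ f ((fam i).act U' u)) ∧
            ∀ u' : (fam i).GT, (fam i).Restricted U₀ u' →
              (fam i).C136 B₁ B₂ (α₀ + α₁) U₀ ((fam i).act U' u') → (fam i).C137 α₁ U₀ ((fam i).act U' u') →
              (fam i).C139 B₁ (α₀ + α₁) U₀ ((fam i).act U' u') → (fam i).LandauF U₀ f ((fam i).act U' u') →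
                u' = u

/-- Bookkeeping (kernel-checked): Theorem 2's existence clause with the hypothesis `Reg335` DISCHARGED —
the form in which B10–B12 use it ("eventually we will drop it out of the assumptions", p. 83) — follows from
Thm 2 as printed plus any implication `InA α₀ U₀ → Reg335 α₀' U₀` (the content of Prop. 6 + B9 Cor. 3.6,
with α₀′ = O(1)·α₀ absorbed into the constants), provided the B9 constants are taken at α₀′. Typed here in
the simplest same-α₀ form. [folklore] -/
theorem thm2_exists_without_reg335 (fam : I → GFData) (h : Thm2Printed fam)
    (hreg : ∀ i α₀ (U₀ : (fam i).Cfg), (fam i).InA α₀ U₀ → (fam i).Reg335 α₀ U₀) :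
    ∃ B₁ B₂ c₁ : ℝ, 0 < B₁ ∧ 0 < B₂ ∧ 0 < c₁ ∧
      ∀ i : I, ∀ α₀ α₁ : ℝ, 0 < α₀ → 0 < α₁ → α₀ + α₁ ≤ c₁ →
        ∀ U₀ : (fam i).Cfg, ∀ U' : (fam i).Pert,
          (fam i).InA α₀ U₀ → (fam i).InAAx α₀ U₀ U' → (fam i).avgClose α₁ U₀ U' →
            ∃ u : (fam i).GT, (fam i).Restricted U₀ u ∧
              (fam i).C136 B₁ B₂ (α₀ + α₁) U₀ ((fam i).act U' u) ∧ (fam i).Landau U₀ ((fam i).act U' u) ∧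
              (fam i).C139 B₁ (α₀ + α₁) U₀ ((fam i).act U' u) := by
  obtain ⟨B₁, B₂, c₁, hB₁, hB₂, hc₁, H⟩ := h
  refine ⟨B₁, B₂, c₁, hB₁, hB₂, hc₁, fun i α₀ α₁ h0 h1 hs U₀ U' hA hAx hcl => ?_⟩
  obtain ⟨u, hu, ⟨h36, _, h38, h39⟩, _⟩ := H i α₀ α₁ h0 h1 hs U₀ U' hA (hreg i α₀ U₀ hA) hAx hcl
  exact ⟨u, hu, h36, h38, h39⟩


/-! ## Phase 2 — paper sub-cell B08 (unit `b2b-balaban-b08`, 2026-08-18)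

Scope (cell rows P08 / T05.1–T05.8).  (i) The full statement of **Proposition 3** ((1.40)–(1.42) + (1.61) ⇒
(1.36)–(1.39) with B₁ = 5dLB₀) over the extended carrier `GFData2`; (ii) the a-priori algebra of Sect. C,
(1.55) + (1.56) + (1.59) ⇒ (1.60) ⇒ (1.62), kernel-checked with its two side conditions (36dB₀α₂ ≤ ½, printed
p. 86; 50dα₂ ≤ 1, NOT printed — census C-B8-8); (iii) the printed proof structures "Theorem 4 + Proposition 3 +
(1.65) ⇒ Theorem 2" (p. 88) over the carrier, with the smallness schedule made explicit, and "Theorem 4 by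
induction on k from Prop. 5, (1.110)–(1.111), Prop. 3 and Prop. 8 of [3]" (pp. 88–95) over named leaves;
(iv) the arithmetic of Sect. F ((1.130) last step ⇔ M > 11d — census G-B8-14; the Thm-4 application inside
Prop. 6 ⇔ L ≤ dM) and the constant 2dL of (1.37); (v) the algebraic identities (1.49)–(1.50) (p. 85) and the
projection identities behind (1.93)–(1.95) (p. 92) as ring identities (second engine); (vi) the sub-cell's
INSPECTION of Theorem 8 (p. 101; GAPS G-B8-13: the ∇- and Hölder clauses of (1.36) do not survive for
lattice-rough f) typed as `Thm8Inspected`; (vii) the bundled leaf `Concl` (= the b8 block of `…Dag.Leaves`).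
The fixed-point / surjectivity certificate for G-B8-05 is NOT repeated: it is `…Balaban1983to89.B8SectE`
(unit adv1, census C-A3-1).  Value = typed skeleton + kernel-checked bookkeeping, NOT summit progress. -/

/-! ### (i) Proposition 3 in full -/

/-- Carrier extension (sub-cell B08): `InAPair α₀ U₀ U₁` = the second clause of (1.40), "U₁U₀ ∈ 𝔄_k({Ω_j}, α₀)"
(plaquette small-field condition only — no axial gauge; gauge invariant); `fGrad U₀ f` = |D^η_{U₀}f|_{(−3)}, the
scaled sup norm of the covariant gradient of a source f ∈ R(U₀) (the hypothesis the inspection G-B8-13 finds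
missing in Theorem 8). [cite: Balaban1985RegularSpaces, (1.40) p.83 + (1.146) p.101] -/
structure GFData2 extends GFData where
  InAPair : ℝ → Cfg → Pert → Prop
  fGrad : Cfg → Src → ℝ

/-- **Proposition 3** with its hypotheses (p. 87 [PDF 13]; (1.40)–(1.42) p. 83, (1.61) p. 86 [PDF 12], verbatim):
*"We assume that we have configurations U₀, U₁U₀ satisfying the following conditions: U₀, U₁U₀ ∈ 𝔄_k({Ω_j}, α₀),
U₀ satisfies the additional regularity condition (3.35) in [4], (1.40)  U₁ = e^{iηA}, |A| < α₂(L^jη)^{−1} on Ω_j,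
(1.41)  R(U₀)D^{η*}_{U₀}A = 0, Q_j(U₀, ηA) = B on Λ_j, |B| < 2dLα₁, (1.42) (j = 0, 1, …, k above)."* …
p. 86, last two lines: *"Now we assume further that 2α₂² + 20dα₀α₂ + 2C₂α₂² ≦ α₀ + α₁. (1.61)"*; p. 87, after
(1.62): *"Let us formulate the results in **Proposition 3.** If U₀, U₁U₀ satisfy (1.40)–(1.42) with α₀, α₁, α₂
bounded by a constant depending on d and L only, and α₂ satisfies the additional restriction (1.61), then U₁
satisfies (1.36)–(1.39) with B₁ = 5dLB₀, B₂(β₀) = 5dLB₀(β₀), where B₀, B₀(β₀) are the corresponding norms of the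
operators G(U₀), H(U₀), and depend on d and L only, B₀(β₀) on β₀ also."*  (Revision v3, cell DIVERGENCE D-pv14.6:
the two sentences were previously merged into one paraphrase inside quotation marks and (1.61) was placed on
p. 87; docstring-only correction, the typed body is unchanged.)  (1.41) is typed as `C162 1 α₂`
(|A| < 1·α₂(L^jη)^{−1}), (1.42) as `Landau ∧ C137 α₁`; C₂ = the constant of Prop. 4 of [3] in (1.56); the
conclusion (1.37)/(1.38) repeats hypotheses and is not restated.  (Revision v3.2, cell GAPS G-adv8-11: the
printed constant B₁ = 5dLB₀ is typed as printed; the audit locates that on the one-bond boundary layer of Ω_j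
the printed derivation yields it only up to further powers of L — immaterial for "depend on d and L only",
recorded for the digits.) [cite: Balaban1985RegularSpaces, (1.61) p.86 + Prop. 3 (1.62) p.87] -/
def Prop3Body (c : ℝ) (d : ℕ) (L C₂ : ℝ) (inp : B9Inputs) (B₀β : ℝ) (fam : I → GFData2) : Prop :=
  ∀ i : I, ∀ α₀ α₁ α₂ : ℝ, 0 < α₀ → α₀ ≤ c → 0 < α₁ → α₁ ≤ c → 0 < α₂ → α₂ ≤ c →
    2 * α₂ ^ 2 + 20 * d * α₀ * α₂ + 2 * C₂ * α₂ ^ 2 ≤ α₀ + α₁ →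
    ∀ U₀ : (fam i).Cfg, ∀ U₁ : (fam i).Pert,
      (fam i).InA α₀ U₀ → (fam i).Reg335 α₀ U₀ → (fam i).InAPair α₀ U₀ U₁ →
      (fam i).C162 1 α₂ U₀ U₁ → (fam i).Landau U₀ U₁ → (fam i).C137 α₁ U₀ U₁ →
        (fam i).C136 (5 * d * L * inp.B₀) (5 * d * L * B₀β) (α₀ + α₁) U₀ U₁ ∧
        (fam i).C139 (5 * d * L * inp.B₀) (α₀ + α₁) U₀ U₁

/-- Proposition 3 (p. 87) = `Prop3Body` for some threshold c(d, L) > 0 ("bounded by a constant depending on d and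
L only"). [cite: Balaban1985RegularSpaces, Prop. 3 p.87] -/
def Prop3Printed (d : ℕ) (L C₂ : ℝ) (inp : B9Inputs) (B₀β : ℝ) (fam : I → GFData2) : Prop :=
  ∃ c : ℝ, 0 < c ∧ Prop3Body c d L C₂ inp B₀β fam

/-- The body of Theorem 4 (p. 88) with the threshold c₁ explicit (`Thm4Printed B₁′ fam ↔ ∃ c₁ > 0, Thm4Body c₁ B₁′ fam`). [cite: Balaban1985RegularSpaces, Thm 4 p.88] -/
def Thm4Body (c₁ B₁' : ℝ) (fam : I → GFData) : Prop :=
  ∀ i : I, ∀ α₀ α₁ : ℝ, 0 < α₀ → 0 < α₁ → α₀ + α₁ ≤ c₁ →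
    ∀ U₀ : (fam i).Cfg, ∀ U' : (fam i).Pert,
      (fam i).InA α₀ U₀ → (fam i).Reg335 α₀ U₀ → (fam i).InAAx α₀ U₀ U' → (fam i).avgClose166 α₁ U₀ U' →
        ∃ u : (fam i).GT, (fam i).Restricted U₀ u ∧
          ((fam i).C137 α₁ U₀ ((fam i).act U' u) ∧ (fam i).Landau U₀ ((fam i).act U' u) ∧
            (fam i).C162 B₁' (α₀ + α₁) U₀ ((fam i).act U' u)) ∧
          ∀ u' : (fam i).GT, (fam i).Restricted U₀ u' →
            (fam i).C137 α₁ U₀ ((fam i).act U' u') → (fam i).Landau U₀ ((fam i).act U' u') →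
            (fam i).C162 B₁' (α₀ + α₁) U₀ ((fam i).act U' u') → u' = u

/-- Kernel: the r1 statement `Thm4Printed` is literally "∃ c₁ > 0, `Thm4Body` c₁". [folklore] -/
theorem thm4Printed_iff (B₁' : ℝ) (fam : I → GFData) :
    Thm4Printed B₁' fam ↔ ∃ c₁ : ℝ, 0 < c₁ ∧ Thm4Body c₁ B₁' fam := Iff.rfl

/-! ### (ii) The a-priori algebra of Sect. C (pp. 86–87) -/

/-- Census C-B8-8 (kernel, second engine): from (1.55) |J|₍₋₃₎ ≤ 2α₀ + 36dα₂|∇A|₍₋₂₎ + 50dα₂³ + 10dα₀α₂, (1.56)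
|B₁| < 2dLα₁ + C₂α₂², (1.59) (each of |A|₍₋₁₎, |∇A|₍₋₂₎, |D*DA|₍₋₃₎, |ΔA|₍₋₃₎ is ≤ B₀(|J|₍₋₃₎ + |B₁|)) and the
printed side condition of p. 86 (verbatim: *"Let us take this bound for |∇^η_{U₀}A|₍₋₂₎ on the left-hand side,
and let us assume that B₀36dα₂ ≦ 1/2."*), each of the four norms obeys the printed (1.60) bound
B₀(4α₀ + 4dLα₁ + 2α₂² + 20dα₀α₂ + 2C₂α₂²) PROVIDED ALSO 50dα₂ ≤ 1 (the bootstrap produces 100dα₂³, which is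
≤ 2α₂² exactly under this unprinted, harmless condition).  Variables: nJ = |J|₍₋₃₎, nB = |B₁|, a, g, j₂, l =
the four norms.  SCOPE (revision v3.2, cell GAPS G-adv8-11 / C-B8-26): the digits 36d, 50d, 10d of `h55` and
C₂α₂² of `h56` are those PRINTED in (1.55)–(1.56); the audit locates (G-adv8-11, adversarial reader adv8-g9) that
on the one-bond boundary layer of Ω_j the derivation (1.43)–(1.54) reads A on bonds of Ω_{j−1} ∖ Ω_j, where
(1.41) is available at level j−1 only, so there the digits carry extra powers of L (or "on Ω_j" is to be read
as the bonds whose η-neighbourhood lies in Ω_j).  This theorem takes (1.55)–(1.56) as HYPOTHESES and certifies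
only the printed algebra (1.55) + (1.56) + (1.59) ⇒ (1.60); it is unaffected by, and silent on, that layer.
(Revision v3.2 also replaces a paraphrase of the p. 86 sentence formerly set in quotation marks by the verbatim
sentence — cell GAPS G-pv13g2-4 item 2; docstring-only, the statement and proof are unchanged.)
[cite: Balaban1985RegularSpaces, (1.55)–(1.60) pp.86–87] -/
theorem apriori_160 {d L C₂ B₀ α₀ α₁ α₂ nJ nB a g j₂ l : ℝ}
    (hd : 0 ≤ d) (hB₀ : 0 ≤ B₀) (hα₂ : 0 ≤ α₂) (hg : 0 ≤ g)
    (h55 : nJ ≤ 2 * α₀ + 36 * d * α₂ * g + 50 * d * α₂ ^ 3 + 10 * d * α₀ * α₂)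
    (h56 : nB ≤ 2 * d * L * α₁ + C₂ * α₂ ^ 2)
    (h59a : a ≤ B₀ * (nJ + nB)) (h59g : g ≤ B₀ * (nJ + nB)) (h59j : j₂ ≤ B₀ * (nJ + nB))
    (h59l : l ≤ B₀ * (nJ + nB))
    (hside : 36 * d * B₀ * α₂ ≤ 1 / 2) (h50 : 50 * d * α₂ ≤ 1) :
    a ≤ B₀ * (4 * α₀ + 4 * d * L * α₁ + 2 * α₂ ^ 2 + 20 * d * α₀ * α₂ + 2 * C₂ * α₂ ^ 2) ∧
    g ≤ B₀ * (4 * α₀ + 4 * d * L * α₁ + 2 * α₂ ^ 2 + 20 * d * α₀ * α₂ + 2 * C₂ * α₂ ^ 2) ∧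
    j₂ ≤ B₀ * (4 * α₀ + 4 * d * L * α₁ + 2 * α₂ ^ 2 + 20 * d * α₀ * α₂ + 2 * C₂ * α₂ ^ 2) ∧
    l ≤ B₀ * (4 * α₀ + 4 * d * L * α₁ + 2 * α₂ ^ 2 + 20 * d * α₀ * α₂ + 2 * C₂ * α₂ ^ 2) := by
  set Y := 2 * α₀ + 50 * d * α₂ ^ 3 + 10 * d * α₀ * α₂ + nB with hY
  -- (1.59) combined with (1.55): every norm is ≤ B₀Y + (36dB₀α₂)·g
  have hJB : nJ + nB ≤ Y + 36 * d * α₂ * g := by rw [hY]; linarith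
  have hstep : B₀ * (nJ + nB) ≤ B₀ * Y + 36 * d * B₀ * α₂ * g := by
    have := mul_le_mul_of_nonneg_left hJB hB₀
    linarith [this]
  have hθg : 36 * d * B₀ * α₂ * g ≤ (1 / 2) * g := by
    have := mul_le_mul_of_nonneg_right hside hg
    linarith [this]
  -- bootstrap for g = |∇A|₍₋₂₎ (p. 86: "(1.55) contains |∇A|₍₋₂₎ … multiplied by B₀36dα₂ … e.g. B₀36dα₂ ≤ ½")
  have hg2 : g ≤ 2 * (B₀ * Y) := by linarith
  have hall : ∀ x, x ≤ B₀ * (nJ + nB) → x ≤ 2 * (B₀ * Y) := fun x hx => by linarith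
  -- 2B₀Y ≤ the printed (1.60) bound, using (1.56) and 100dα₂³ ≤ 2α₂² (⇐ 50dα₂ ≤ 1)
  have hdα : 0 ≤ d * α₂ := mul_nonneg hd hα₂
  have hcube : 100 * d * α₂ ^ 3 ≤ 2 * α₂ ^ 2 := by nlinarith [sq_nonneg α₂, hdα]
  have hfin : 2 * (B₀ * Y) ≤
      B₀ * (4 * α₀ + 4 * d * L * α₁ + 2 * α₂ ^ 2 + 20 * d * α₀ * α₂ + 2 * C₂ * α₂ ^ 2) := by
    have hin : 2 * Y ≤ 4 * α₀ + 4 * d * L * α₁ + 2 * α₂ ^ 2 + 20 * d * α₀ * α₂ + 2 * C₂ * α₂ ^ 2 := by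
      rw [hY]; linarith
    have := mul_le_mul_of_nonneg_left hin hB₀
    linarith [this]
  exact ⟨(hall a h59a).trans hfin, hg2.trans hfin, (hall j₂ h59j).trans hfin, (hall l h59l).trans hfin⟩

/-- Census C-B8-9 (kernel, second engine for the constant B₁ = 5dLB₀ of Prop. 3, p. 87): under (1.61)
2α₂² + 20dα₀α₂ + 2C₂α₂² ≤ α₀ + α₁ and dL ≥ 1 the (1.60) bound is ≤ 5dLB₀(α₀ + α₁), i.e. (1.62).  SCOPE as for
`apriori_160` (revision v3.2, cell GAPS G-adv8-11): the digits are the printed ones; the one-bond boundary layer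
of Ω_j, where the audit locates extra L-powers, is not examined by this algebra. [cite: Balaban1985RegularSpaces, (1.61)–(1.62) p.87] -/
theorem apriori_162 {d L C₂ B₀ α₀ α₁ α₂ : ℝ} (hB₀ : 0 ≤ B₀) (hdL : 1 ≤ d * L) (hα₀ : 0 ≤ α₀) (hα₁ : 0 ≤ α₁)
    (h61 : 2 * α₂ ^ 2 + 20 * d * α₀ * α₂ + 2 * C₂ * α₂ ^ 2 ≤ α₀ + α₁) :
    B₀ * (4 * α₀ + 4 * d * L * α₁ + 2 * α₂ ^ 2 + 20 * d * α₀ * α₂ + 2 * C₂ * α₂ ^ 2) ≤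
      5 * d * L * B₀ * (α₀ + α₁) := by
  have h : 4 * α₀ + 4 * d * L * α₁ + 2 * α₂ ^ 2 + 20 * d * α₀ * α₂ + 2 * C₂ * α₂ ^ 2 ≤
      5 * d * L * (α₀ + α₁) := by
    nlinarith [mul_nonneg (sub_nonneg.2 hdL) hα₀, mul_nonneg (sub_nonneg.2 hdL) hα₁]
  calc B₀ * (4 * α₀ + 4 * d * L * α₁ + 2 * α₂ ^ 2 + 20 * d * α₀ * α₂ + 2 * C₂ * α₂ ^ 2)
      ≤ B₀ * (5 * d * L * (α₀ + α₁)) := mul_le_mul_of_nonneg_left h hB₀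
    _ = 5 * d * L * B₀ * (α₀ + α₁) := by ring

/-! ### (iii-a) "Theorem 4 + Proposition 3 + (1.65) ⇒ Theorem 2" (p. 88) -/

/-- Kernel (the smallness schedule of the reduction Thm 4 ⇒ Thm 2, made explicit; the paper says only
"α₀ + α₁ ≤ c₁"): given the thresholds c₀ of (1.65), c₄ of Theorem 4, c₃ of Proposition 3, the constant B′₁ > 0 of
(1.67) and C₂ ≥ 0 of (1.56), there is c₁ > 0 such that α₀ + α₁ ≤ c₁ forces: α₀ ≤ c₀; Theorem 4 applicable at
(α₀, α₁′) with α₁′ = 11d²α₀ + α₁ (from (1.65)); Proposition 3 applicable at (α₀, α₁, α₂) with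
α₂ = B′₁(α₀ + α₁′), including the restriction (1.61) — the computation behind (1.63)–(1.64). [cite: Balaban1985RegularSpaces, (1.63)–(1.67) pp.87–88] -/
theorem thm2_schedule_exists {d c₀ c₃ c₄ B₁' C₂ : ℝ} (hd : 0 ≤ d) (hc₀ : 0 < c₀) (hc₃ : 0 < c₃) (hc₄ : 0 < c₄)
    (hB : 0 < B₁') (hC₂ : 0 ≤ C₂) :
    ∃ c₁ : ℝ, 0 < c₁ ∧ ∀ α₀ α₁ : ℝ, 0 < α₀ → 0 < α₁ → α₀ + α₁ ≤ c₁ →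
      α₀ ≤ c₀ ∧ α₀ + (11 * d ^ 2 * α₀ + α₁) ≤ c₄ ∧ α₀ ≤ c₃ ∧ α₁ ≤ c₃ ∧
      B₁' * (α₀ + (11 * d ^ 2 * α₀ + α₁)) ≤ c₃ ∧
      2 * (B₁' * (α₀ + (11 * d ^ 2 * α₀ + α₁))) ^ 2 + 20 * d * α₀ * (B₁' * (α₀ + (11 * d ^ 2 * α₀ + α₁))) +
        2 * C₂ * (B₁' * (α₀ + (11 * d ^ 2 * α₀ + α₁))) ^ 2 ≤ α₀ + α₁ := by
  set K : ℝ := 1 + 11 * d ^ 2 with hK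
  have hK1 : 1 ≤ K := by rw [hK]; nlinarith [sq_nonneg d]
  have hKpos : 0 < K := by linarith
  set D : ℝ := B₁' * K * (2 * (1 + C₂) * B₁' * K + 20 * d) + 1 with hD
  have hDpos : 0 < D := by
    have : 0 ≤ B₁' * K * (2 * (1 + C₂) * B₁' * K + 20 * d) := by positivity
    linarith
  refine ⟨min c₀ (min (c₄ / K) (min c₃ (min (c₃ / (B₁' * K)) (1 / D)))), ?_, ?_⟩
  · refine lt_min hc₀ (lt_min (by positivity) (lt_min hc₃ (lt_min (by positivity) (by positivity))))
  intro α₀ α₁ h0 h1 hs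
  set s := α₀ + α₁ with hs_def
  have hs0 : 0 < s := by linarith
  have e1 : s ≤ c₀ := hs.trans (min_le_left _ _)
  have e2 : s ≤ c₄ / K := hs.trans ((min_le_right _ _).trans (min_le_left _ _))
  have e3 : s ≤ c₃ := hs.trans ((min_le_right _ _).trans ((min_le_right _ _).trans (min_le_left _ _)))
  have e4 : s ≤ c₃ / (B₁' * K) :=
    hs.trans ((min_le_right _ _).trans ((min_le_right _ _).trans ((min_le_right _ _).trans (min_le_left _ _))))
  have e5 : s ≤ 1 / D :=
    hs.trans ((min_le_right _ _).trans ((min_le_right _ _).trans ((min_le_right _ _).trans (min_le_right _ _))))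
  -- the auxiliary quantity α₀ + α₁′ = Kα₀ + α₁ ≤ K s
  have hKs : α₀ + (11 * d ^ 2 * α₀ + α₁) ≤ K * s := by
    rw [hK, hs_def]; nlinarith [sq_nonneg d, mul_nonneg (mul_nonneg (by norm_num : (0:ℝ) ≤ 11) (sq_nonneg d)) h1.le]
  have hKs0 : 0 ≤ α₀ + (11 * d ^ 2 * α₀ + α₁) := by positivity
  refine ⟨by linarith, ?_, by linarith, by linarith, ?_, ?_⟩
  · have : K * s ≤ c₄ := by
      have := (le_div_iff₀ hKpos).1 e2; linarith
    linarith
  · have hBK : B₁' * (α₀ + (11 * d ^ 2 * α₀ + α₁)) ≤ B₁' * K * s := by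
      have := mul_le_mul_of_nonneg_left hKs hB.le; linarith [this]
    have : B₁' * K * s ≤ c₃ := by
      have hBKpos : 0 < B₁' * K := by positivity
      have := (le_div_iff₀ hBKpos).1 e4; linarith
    linarith
  · -- (1.61) at α₂ = B′₁(α₀ + α₁′): 2(1+C₂)α₂² + 20dα₀α₂ ≤ s²·B′₁K(2(1+C₂)B′₁K + 20d) ≤ s²D ≤ s
    set α₂ := B₁' * (α₀ + (11 * d ^ 2 * α₀ + α₁)) with hα₂
    have hα₂0 : 0 ≤ α₂ := by positivity
    have hα₂le : α₂ ≤ B₁' * K * s := by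
      have := mul_le_mul_of_nonneg_left hKs hB.le; rw [hα₂]; linarith [this]
    have hsq : α₂ ^ 2 ≤ (B₁' * K * s) ^ 2 := by
      exact pow_le_pow_left₀ hα₂0 hα₂le 2
    have hα₀s : α₀ ≤ s := by linarith
    have hprod : α₀ * α₂ ≤ s * (B₁' * K * s) :=
      mul_le_mul hα₀s hα₂le hα₂0 hs0.le
    have hsD : s * D ≤ 1 := by
      have := (le_div_iff₀ hDpos).1 e5; linarith
    have hmain : 2 * α₂ ^ 2 + 20 * d * α₀ * α₂ + 2 * C₂ * α₂ ^ 2 ≤ s * (s * D) := by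
      have h2 : 2 * (1 + C₂) * α₂ ^ 2 ≤ 2 * (1 + C₂) * (B₁' * K * s) ^ 2 :=
        mul_le_mul_of_nonneg_left hsq (by positivity)
      have h3 : 20 * d * (α₀ * α₂) ≤ 20 * d * (s * (B₁' * K * s)) :=
        mul_le_mul_of_nonneg_left hprod (by positivity)
      have hss : 0 ≤ s * s := by positivity
      rw [hD]; nlinarith [h2, h3, hss]
    have : s * (s * D) ≤ s := by
      have := mul_le_mul_of_nonneg_left hsD hs0.le; simpa using this
    linarith

/-- The printed reduction **Theorem 4 ⇒ Theorem 2** (p. 88: "Thus Theorem 4 implies Theorem 2 … by Prop. 3 it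
suffices to prove (1.37), (1.38) and |A| < B′₁(α₀ + α₁)(L^jη)^{−1}", with (1.35) ⇒ (1.66) in the form (1.65)
|Ũ′^j − 1| < 11d²α₀ + α₁), kernel-checked over the carrier.  The bookkeeping facts the text uses are the named
hypotheses: `h165` = (1.65) (Lemma 1 iterated + Prop. 2 of [3], for α₀ ≤ c₀); `hginv` = gauge invariance of
𝔄_k ((1.34) ⇒ (U′U₀)^{u⁻¹} = U₁U₀ ∈ 𝔄_k, the second clause of (1.40)); `h137` = "(1.37) is basically of an
algebraic character and it follows from the construction, as in (1.30), (1.31). The only fact we need … is the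
representation of U₁ and the first condition on A in (1.36)" (p. 83); `h136_162` = (1.62) is the first clause
of (1.36); `hmono162`, `hmono137` = monotonicity of the bounds in their constants; `hB₁'` = B₁ ≤ B′₁
(B′₁ = C′₁B₁, C′₁ = (2 + 16B′₀)L ≥ 1, (1.111)).  SUB-CELL OBSERVATION (census C-B8-12): Theorem 4 is invoked
at (α₀, 11d²α₀ + α₁), so the (1.37) it returns has constant 2dL(11d²α₀ + α₁); Theorem 2's (1.37) with 2dLα₁
is not inherited from Theorem 4 but comes from (1.35) directly via `h137` — consistent with p. 83 but unstated
on p. 88.  The constants of Theorem 2 come out as B₁ = 5dLB₀, B₂ = 5dLB₀(β₀) (Prop. 3's), c₁ from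
`thm2_schedule_exists`. [cite: Balaban1985RegularSpaces, Thm 4 ⇒ Thm 2 p.88] -/
theorem thm2_of_thm4_prop3 (d : ℕ) (L C₂ B₁' : ℝ) (inp : B9Inputs) (B₀β : ℝ) (fam : I → GFData2)
    (hd : 1 ≤ d) (hL : 0 < L) (hB₀β : 0 < B₀β) (hC₂ : 0 ≤ C₂) (hB₁' : 5 * d * L * inp.B₀ ≤ B₁')
    (h4 : Thm4Printed B₁' (fun i => (fam i).toGFData))
    (h3 : Prop3Printed d L C₂ inp B₀β fam)
    (c₀ : ℝ) (hc₀ : 0 < c₀)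
    (h165 : ∀ i α₀ α₁ (U₀ : (fam i).Cfg) (U' : (fam i).Pert), 0 < α₀ → α₀ ≤ c₀ →
      (fam i).InA α₀ U₀ → (fam i).InAAx α₀ U₀ U' → (fam i).avgClose α₁ U₀ U' →
      (fam i).avgClose166 (11 * d ^ 2 * α₀ + α₁) U₀ U')
    (hginv : ∀ i α₀ (U₀ : (fam i).Cfg) (U' : (fam i).Pert) (u : (fam i).GT),
      (fam i).InAAx α₀ U₀ U' → (fam i).InAPair α₀ U₀ ((fam i).act U' u))
    (h137 : ∀ i α₁ b s (U₀ : (fam i).Cfg) (U' : (fam i).Pert) (u : (fam i).GT), (fam i).avgClose α₁ U₀ U' →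
      (fam i).Restricted U₀ u → (fam i).C162 b s U₀ ((fam i).act U' u) → (fam i).C137 α₁ U₀ ((fam i).act U' u))
    (h136_162 : ∀ i b b₂ s (U₀ : (fam i).Cfg) (U₁ : (fam i).Pert),
      (fam i).C136 b b₂ s U₀ U₁ → (fam i).C162 b s U₀ U₁)
    (hmono162 : ∀ i b s b' s' (U₀ : (fam i).Cfg) (U₁ : (fam i).Pert), b * s ≤ b' * s' →
      (fam i).C162 b s U₀ U₁ → (fam i).C162 b' s' U₀ U₁)
    (hmono137 : ∀ i α₁ α₁' (U₀ : (fam i).Cfg) (U₁ : (fam i).Pert), α₁ ≤ α₁' →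
      (fam i).C137 α₁ U₀ U₁ → (fam i).C137 α₁' U₀ U₁) :
    Thm2Printed (fun i => (fam i).toGFData) := by
  obtain ⟨c₄, hc₄, H4⟩ := h4
  obtain ⟨c₃, hc₃, H3⟩ := h3
  have hd' : (0 : ℝ) ≤ d := by positivity
  have hB₀ : 0 < inp.B₀ := inp.B₀_pos
  have hB₁pos : 0 < 5 * d * L * inp.B₀ := by positivity
  have hB₁'pos : 0 < B₁' := lt_of_lt_of_le hB₁pos hB₁'
  obtain ⟨c₁, hc₁, sched⟩ := thm2_schedule_exists (d := (d : ℝ)) hd' hc₀ hc₃ hc₄ hB₁'pos hC₂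
  refine ⟨5 * d * L * inp.B₀, 5 * d * L * B₀β, c₁, hB₁pos, by positivity, hc₁, ?_⟩
  intro i α₀ α₁ h0 h1 hs U₀ U' hA hReg hAx hcl
  obtain ⟨e0, e4, e3a, e3b, e3c, e61⟩ := sched α₀ α₁ h0 h1 hs
  set α₁' := 11 * (d : ℝ) ^ 2 * α₀ + α₁ with hα₁'
  have hα₁'pos : 0 < α₁' := by rw [hα₁']; positivity
  have hle' : α₁ ≤ α₁' := by rw [hα₁']; nlinarith [sq_nonneg (d : ℝ)]
  -- (1.65): the hypotheses (1.33)–(1.35) give (1.66) with α₁′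
  have h166 := h165 i α₀ α₁ U₀ U' h0 e0 hA hAx hcl
  -- Theorem 4 at (α₀, α₁′)
  obtain ⟨u, hu, ⟨h37', h38, h62⟩, huniq⟩ := H4 i α₀ α₁' h0 hα₁'pos e4 U₀ U' hA hReg hAx h166
  -- Proposition 3 at (α₀, α₁, α₂ = B′₁(α₀ + α₁′)) for U₁ = U′^{u⁻¹}
  set α₂ := B₁' * (α₀ + α₁') with hα₂
  have hα₂pos : 0 < α₂ := by rw [hα₂]; positivity
  have h41 : (fam i).C162 1 α₂ U₀ ((fam i).act U' u) :=
    hmono162 i B₁' (α₀ + α₁') 1 α₂ U₀ _ (by rw [hα₂]; ring_nf; rfl) h62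
  have h37 : (fam i).C137 α₁ U₀ ((fam i).act U' u) := h137 i α₁ B₁' (α₀ + α₁') U₀ U' u hcl hu h62
  obtain ⟨h36, h39⟩ := H3 i α₀ α₁ α₂ h0 e3a h1 e3b hα₂pos e3c e61 U₀ ((fam i).act U' u)
    hA hReg (hginv i α₀ U₀ U' u hAx) h41 h38 h37
  refine ⟨u, hu, ⟨h36, h37, h38, h39⟩, ?_⟩
  -- uniqueness: a second restricted u′ with (1.36)–(1.39) satisfies Theorem 4's (1.37)[α₁′], (1.38), (1.62)[B′₁(α₀+α₁′)]
  intro u' hu' h36' h37u _ _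
  refine huniq u' hu' (hmono137 i α₁ α₁' U₀ _ hle' h37u) ‹_› ?_
  have hbs : 5 * d * L * inp.B₀ * (α₀ + α₁) ≤ B₁' * (α₀ + α₁') :=
    mul_le_mul hB₁' (by linarith) (by positivity) hB₁'pos.le
  exact hmono162 i _ _ _ _ U₀ _ hbs (h136_162 i _ _ _ U₀ _ h36')

/-! ### (iii-b) Theorem 4 by induction on k (pp. 88–95) -/

/-- The printed proof structure of **Theorem 4** over named leaves indexed by the number of steps k ≥ 1:
`T4 k` = Theorem 4 for all geometric data with k steps (constants fixed); `Ind k` = the inductive input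
(1.68)–(1.69) at level k (a transformation u₁ restricted at level k − 1 with the (1.36)-type bounds
B₁(α₀ + α₁) on Ω_j, j ≤ k − 1, "taking Λ_{k−1} ∪ B(Λ_k) as Λ_{k−1}", p. 88); `P5 k` = Proposition 5 at level k
(existence (1.107)–(1.108), uniqueness (1.109)); `E110 k` = the estimate (1.110)–(1.111)
(|(1/iη) log(U₁^{u′⁻¹})_b| < (2 + 16B′₀)LB₁(α₀ + α₁)(L^jη)^{−1} = C′₁B₁(α₀ + α₁)(L^jη)^{−1}, p. 95); `P3 k` =
Proposition 3 at level k; `P8B7` = Proposition 8 of [3] (used in (1.112)); `base` = p. 89: "For k = 1 we can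
simply take u₁ = 1 and then (1.69) is satisfied by Lemma 1, at least for B₁ not too small, e.g., for B₀
satisfying 5dLB₀ ≥ 8d²" (sub-cell census: the margin needs 5dLB₀ ≥ 8d²(1 + O(α)), rounding only);
`ind_of` = p. 88: Theorem 4 at level k together with Proposition 3 (to upgrade (1.62) to the (1.36)-bounds of
(1.69)) give the input at level k + 1; `t4_of` = pp. 94–95: existence from the input, Prop. 5 and
(1.110)–(1.111) (then Prop. 3 applies), uniqueness (1.112) from Prop. 5's uniqueness and Prop. 8 of [3].
Nothing but the shape of the induction is asserted. [cite: Balaban1985RegularSpaces, proof of Thm 4 pp.88–95] -/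
structure Thm4Skeleton where
  T4 : ℕ → Prop
  Ind : ℕ → Prop
  P5 : ℕ → Prop
  E110 : ℕ → Prop
  P3 : ℕ → Prop
  P8B7 : Prop
  base : Ind 1
  ind_of : ∀ k, 1 ≤ k → T4 k → P3 k → Ind (k + 1)
  t4_of : ∀ k, 1 ≤ k → Ind k → P5 k → E110 k → P3 k → P8B7 → T4 k

/-- Kernel: the induction on k of pp. 88–95 closes — Theorem 4 holds at every level k ≥ 1 given Prop. 5,
(1.110)–(1.111), Prop. 3 at every level and Prop. 8 of [3]. [cite: Balaban1985RegularSpaces, proof of Thm 4 pp.88–95] -/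
theorem Thm4Skeleton.thm4_all (S : Thm4Skeleton) (hP5 : ∀ k, S.P5 k) (hE : ∀ k, S.E110 k)
    (hP3 : ∀ k, S.P3 k) (h8 : S.P8B7) : ∀ k, 1 ≤ k → S.T4 k := by
  intro k hk
  induction k with
  | zero => exact absurd hk (by norm_num)
  | succ n ih =>
    rcases Nat.eq_zero_or_pos n with h0 | hpos
    · subst h0
      exact S.t4_of 1 le_rfl S.base (hP5 1) (hE 1) (hP3 1) h8
    · exact S.t4_of (n + 1) hk (S.ind_of n hpos (ih hpos) (hP3 n)) (hP5 (n + 1)) (hE (n + 1)) (hP3 (n + 1)) h8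

/-! ### (iii-c) Theorem 4 — the uniqueness half (p. 95) and the hypothesis of Proposition 5 (census G-adv8-13)

REVISION v4 (paper sub-cell B08 gen 7, 2026-08-18), APPEND-ONLY.  The cell's hostile reading adv8-g12 (GAPS
G-adv8-13) locates a hypothesis mismatch in the uniqueness paragraph of Theorem 4, p. 95 [PDF 21], verbatim:
*"To prove the uniqueness let us assume that there are two transformations u₁, u₂ satisfying the conditions of the
Theorem 4. Then we have two configurations U₁ = U′^{u₁⁻¹}, U₂ = U′^{u₂⁻¹}, U₁ = e^{iηA₁}, U₂ = e^{iηA₂}. They satisfy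
all the conditions of the theorem, hence A₂ satisfies (1.37), (1.38), and both configurations A₁, A₂ satisfy the
bounds (1.62). This implies that u′ = u₂u₁⁻¹ satisfies the regularity conditions (1.73), (1.74) with k instead of
k − 1 and with a worse constant. This follows from Proposition 8 of [3]. We have u′u₁ = u₂, hence R₀u′u₁‾^j = 1 on
Λ_j, j = 0, 1, …, k, U₁^{u′⁻¹} = U₂, (1.112) thus u′ is a solution of the problem described in Proposition 5. For
α₀ + α₁ sufficiently small the assumptions of this proposition are satisfied and we have the uniqueness property. In
the considered case a configuration identically equal to 1 is a solution also, because U₁ satisfies the same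
conditions as U₂. The uniqueness implies u′ = 1, or u₁ = u₂. Thus we have completed the proof of Theorem 4, and
Theorem 2."*

Proposition 5 (p. 94 [PDF 20]) is stated *"for an arbitrary configuration U₁ satisfying (1.69), and for the
configuration u₁ determined by U₁ and satisfying (1.68), (1.73), (1.74)"*, and (1.68) (p. 88 [PDF 14]) is the
INDUCTIVE gauge condition *"(R₀u₁‾)^j(y) = 1 for y ∈ Λ_j, j = 0, 1, …, k − 2, and for y ∈ Λ_{k−1} ∪ B(Λ_k),
j = k − 1, (1.68)"*.  At p. 95 the rôle of u₁ is played by a level-k SOLUTION, which satisfies (1.29)_k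
(p. 81: *"(R₀u‾^j)(y) = 1 for y ∈ Λ_j, j = 0, 1, …, k. (1.29)"*) and not (1.68); the printed implication goes the other way,
p. 90 [PDF 16]: *"The transformation u′u₁ has to satisfy the conditions (1.29), and u₁ satisfies (1.68). Of course
(R₀u₁‾^{k−1})(x) = 1 for x ∈ B(Λ_k) implies (R₀u₁‾^k)(y) = 1 for y ∈ Λ_k, hence u₁ satisfies the conditions (1.29)
and we may write these conditions for u′u₁ in the following way ũ′^j = R₀u′u₁‾^j(R₀u₁‾^j)⁻¹ = 1 on Λ_j,
j = 0, 1, …, k, (1.78)"* — so of u₁'s GAUGE CONDITIONS the equations of Sects. D–E use only (1.29)_k [REVISION v5,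
census G-A23-1: v4 wrote here "(1.78), i.e. (1.29)_k for u₁, is all that Sects. D–E use of (1.68)", which is
false as stated — Sect. D, p. 89, ALSO feeds Proposition 10 of [3] with u₁'s regularity (166)/(167) of [3] on
B^j(Λ_j) for every j ≤ k, and on the Λ_k region that regularity is derived (p. 88, via (106) of [3]) from
(1.68)'s B(Λ_k)-clause and stated through the convention "(we take Λ_{k−1}∪B(Λ_k) as Λ_{k−1})" of (1.74); the
top instance of (167) there holds because both its averages equal 1 by the same clause — see § (iii-d)]; the
author's own list, p. 89 [PDF 15]: *"We will use only the properties (1.69), (1.73), (1.74) of the configurations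
u₁, U₁ in the future."*  REPAIR (adv8-g12; confirmed by the sub-cell on the renders pp. 88–90, 94–95; range made
explicit in v5): read Proposition 5 with the hypothesis "(1.29)_k and (1.69), and (1.73), (1.74) WITH k INSTEAD
OF k − 1 (on the honest sets Λ₀, …, Λ_k)" in place of "(1.68), (1.69), (1.73), (1.74)"; the repaired statement
IMPLIES the printed one (p. 90: (1.68) ⇒ (1.29)_k; and (1.68) with the printed-range (1.73)–(1.74) ⇒ the level-k
form, the missing instances vanishing — § (iii-d) `GaugeCalcL.lev_of_68`), and it is what pp. 90–94 prove once
Sects. D–E are run on the honest level-k sets in place of the (k − 1)-convention sets (α₃ = 16dB₁(α₀ + α₁),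
α₄ = 32dB₁(α₀ + α₁) as printed; no display changes its form, the displays are instantiated a second time —
v4's "No display and no constant of the paper changes" overstated this, G-A23-1).  For the p. 95 application
the level-k regularity of a level-k SOLUTION u₁ is an input the paper never states for u₁ (p. 95 asserts
"(1.73), (1.74) with k instead of k − 1" of u′ = u₂u₁⁻¹ only, "This follows from Proposition 8 of [3]" — whose
own hypothesis, p. 45 of [3], is u₁, u₂ ∈ Λ_k(U₀, α₃) individually): it is the level-k RE-RUN of (1.70)–(1.74)
from (1.29)_k and (1.62), the binder `hReg` below (named `Rerun7074AtK` in § (iii-d)) — an unprinted step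
located by the cell (adv1-g18, G-A23-1), absorbed in print by "For α₀ + α₁ sufficiently small the assumptions of
this proposition are satisfied".  SUB-CELL SHARPENING of "with a worse constant … for α₀ + α₁ sufficiently small"
(p. 95): for U₁ = U′^{u₁⁻¹} with u₁ a level-k solution, (1.69) is NOT among "the conditions of the theorem"
((1.37), (1.38), (1.62) give |A₁| < B′₁(α₀ + α₁)(L^jη)⁻¹ only, B′₁ = C′₁B₁, and no gradient bound); it follows —
with the constant B₁ = 5dLB₀ itself, on every Ω_j, j ≤ k — from Proposition 3 at level k, whose hypotheses
(1.40)–(1.42) are (1.33) + the gauge invariance of 𝔄_k, (1.41) with α₂ = B′₁(α₀ + α₁) from (1.62), (1.38) and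
(1.37), under the d, L-only restriction (1.61)/(1.64) on α₀ + α₁ — the same application of Proposition 3 the
existence half makes four lines earlier ("Thus all the assumptions of Proposition 3 are satisfied"); and u₁'s own
(1.73)–(1.74) "with k instead of k − 1" derive as in (1.70)–(1.74), p. 88, with B′₁ for B₁ ((106) of [3] with k
levels, (130) of [3] with (1.62) for (1.69) — the unprinted re-run, G-A23-1).

What this section records.  (1) `Thm4SkeletonR`: the induction of pp. 88–95 with the Proposition-5 leaf SPLIT —
`P5e k` (existence (1.107)–(1.108), consumed with the inductive u₁ of (1.68)) and `P5u k` (uniqueness (1.109) in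
the repaired (1.29)_k form, consumed with a level-k solution and WITHOUT the inductive input) — closing by the same
induction (`thm4R_all`; the uniqueness half needs no induction, `t4u_all`); the Phase-2 skeleton `Thm4Skeleton` is
its coarsening `toSkeleton` (P5 k := P5e k ∧ P5u k), so the landed skeleton is not wrong, only too coarse to show
which hypothesis form of Proposition 5 each branch consumes.  (2) At carrier level, over `GFData2` and the
gauge-transformation calculus the paragraph uses (`GaugeCalc`: composition, unit, inverse, the action law
U′^{(u′u₁)⁻¹} = (U′^{u₁⁻¹})^{u′⁻¹} behind (1.112), and the named predicates (1.69), (1.73)–(1.74), (1.109),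
(1.68)), the uniqueness clause of Theorem 4 (`Thm4UniqueBody`) is DERIVED (`thm4Unique_of_prop5R`) from:
Proposition 5's uniqueness in the repaired form (`Prop5UniqueR`), Proposition 3 at level k (`Prop3Body`), the
Prop.-8-of-[3] smallness of λ = (1/i) log u₂u₁⁻¹ and the LEVEL-k regularity of a level-k solution (the
hypothesis shapes `hP8`, `hReg` — the p. 95 sentence / the level-k re-run of p. 88's derivation, unprinted for u₁
(G-A23-1), not re-proved here), the
gauge invariance of 𝔄_k and the monotonicity of (1.62) in its constant; `thm4Body_iff_halves` /
`thm4Printed_of_halves` reassemble `Thm4Body` / `Thm4Printed` from the two halves.  (3) `Prop5UniquePrinted68` is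
the same uniqueness statement with the PRINTED hypothesis (1.68): `prop5UniquePrinted68_of_R` (repaired ⇒ printed,
by p. 90) and `prop5UniqueR_of_printed68` (printed ⇒ repaired GIVEN the converse (1.29)_k ⇒ (1.68)) isolate exactly
what the p. 95 quotation of Proposition 5 presupposes on the gauge-condition clause (both variants carry the
level-k regularity binder; the fully printed range is `Prop5UniquePrintedPr`, § (iii-d)); `toy_129_not_68` is a
decidable shape-level witness that the converse fails (one block-average constraint does not force the site
values).  Value = kernel certificate of a located gap (hypothesis form of a quoted proposition), NOT summit
progress; census C-B8-27 (v4), C-B8-29 (v5 corrections, G-A23-1). -/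

/-- The printed proof structure of **Theorem 4** (pp. 88–95) with the Proposition-5 leaf SPLIT according to the
hypothesis form under which each half is invoked (census G-adv8-13; refines `Thm4Skeleton`).  `T4e k` / `T4u k` =
the existence / uniqueness half of Theorem 4 for all geometric data with k steps (constants fixed); `Ind k` = the
inductive input (1.68)–(1.69) at level k (with (1.70)–(1.74)); `P5e k` = Proposition 5, existence (1.107)–(1.108),
for "the configuration u₁ determined by U₁ and satisfying (1.68), (1.73), (1.74)" as printed (p. 94: invoked with
the inductive u₁); `P5u k` = Proposition 5, uniqueness (1.109), in the REPAIRED form "u₁ satisfying (1.29)_k and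
(1.73), (1.74) with k instead of k − 1" (p. 95: invoked with u₁ := a level-k solution; typed at carrier level as
`Prop5UniqueR`); `E110 k` =
(1.110)–(1.111); `P3 k` = Proposition 3 at level k; `P8B7` = Proposition 8 of [3].  `base` = p. 89 (k = 1, u₁ = 1,
Lemma 1); `ind_of` = p. 88: the input at level k + 1 comes from the EXISTENCE half at level k and Proposition 3
("Applying the inductive hypothesis we get a gauge transformation u₁ such that (1.68) …"; "u₁ is determined uniquely
in terms of U₁" is (64)–(87) of [3], not the uniqueness half of Theorem 4); `t4e_of` = pp. 94–95: existence from
the input, `P5e`, (1.110)–(1.111) and Proposition 3; `t4u_of` = p. 95: uniqueness from `P5u`, Proposition 3 at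
level k (which supplies (1.69) for U₁ = U′^{u₁⁻¹}) and Proposition 8 of [3] — and NOT from `Ind k` (revision v5,
census G-A23-1: the level-k regularity of the two solutions, the individual input of Proposition 8 of [3] that
p. 95 does not state, is hidden in this leaf exactly as in print; `Thm4SkeletonL` of § (iii-d) names it `R74 k`).
Nothing but the shape of the induction is asserted. [cite: Balaban1985RegularSpaces, proof of Thm 4 pp.88–95] -/
structure Thm4SkeletonR where
  T4e : ℕ → Prop
  T4u : ℕ → Prop
  Ind : ℕ → Prop
  P5e : ℕ → Prop
  P5u : ℕ → Prop
  E110 : ℕ → Prop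
  P3 : ℕ → Prop
  P8B7 : Prop
  base : Ind 1
  ind_of : ∀ k, 1 ≤ k → T4e k → P3 k → Ind (k + 1)
  t4e_of : ∀ k, 1 ≤ k → Ind k → P5e k → E110 k → P3 k → T4e k
  t4u_of : ∀ k, 1 ≤ k → P5u k → P3 k → P8B7 → T4u k

/-- Kernel: the refined induction closes — both halves of Theorem 4 hold at every level k ≥ 1 given the two
halves of Proposition 5 (each in the hypothesis form its branch consumes), (1.110)–(1.111), Proposition 3 at every
level and Proposition 8 of [3]; the induction runs through the existence halves only. [cite: Balaban1985RegularSpaces, proof of Thm 4 pp.88–95] -/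
theorem Thm4SkeletonR.thm4R_all (S : Thm4SkeletonR) (hP5e : ∀ k, S.P5e k) (hP5u : ∀ k, S.P5u k)
    (hE : ∀ k, S.E110 k) (hP3 : ∀ k, S.P3 k) (h8 : S.P8B7) : ∀ k, 1 ≤ k → S.T4e k ∧ S.T4u k := by
  have hex : ∀ k, 1 ≤ k → S.T4e k := by
    intro k hk
    induction k with
    | zero => exact absurd hk (by norm_num)
    | succ n ih =>
      rcases Nat.eq_zero_or_pos n with h0 | hpos
      · subst h0
        exact S.t4e_of 1 le_rfl S.base (hP5e 1) (hE 1) (hP3 1)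
      · exact S.t4e_of (n + 1) hk (S.ind_of n hpos (ih hpos) (hP3 n)) (hP5e (n + 1)) (hE (n + 1)) (hP3 (n + 1))
  exact fun k hk => ⟨hex k hk, S.t4u_of k hk (hP5u k) (hP3 k) h8⟩

/-- Kernel: the uniqueness half of Theorem 4 at level k consumes no inductive input — it is `P5u k`, `P3 k` and
Proposition 8 of [3] alone (p. 95). [cite: Balaban1985RegularSpaces, proof of Thm 4 p.95] -/
theorem Thm4SkeletonR.t4u_all (S : Thm4SkeletonR) (hP5u : ∀ k, S.P5u k) (hP3 : ∀ k, S.P3 k) (h8 : S.P8B7) :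
    ∀ k, 1 ≤ k → S.T4u k :=
  fun k hk => S.t4u_of k hk (hP5u k) (hP3 k) h8

/-- The Phase-2 skeleton as the COARSENING of the refined one: `T4 k := T4e k ∧ T4u k`, `P5 k := P5e k ∧ P5u k`
(the coarse `t4_of` feeds `Ind k` to both branches; the refined data show the uniqueness branch ignores it).
So `Thm4Skeleton` is not wrong — it cannot display the hypothesis form of Proposition 5, which is the content of
census G-adv8-13. [cite: Balaban1985RegularSpaces, proof of Thm 4 pp.88–95] -/
def Thm4SkeletonR.toSkeleton (S : Thm4SkeletonR) : Thm4Skeleton where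
  T4 := fun k => S.T4e k ∧ S.T4u k
  Ind := S.Ind
  P5 := fun k => S.P5e k ∧ S.P5u k
  E110 := S.E110
  P3 := S.P3
  P8B7 := S.P8B7
  base := S.base
  ind_of := fun k hk h4 h3 => S.ind_of k hk h4.1 h3
  t4_of := fun k hk hI h5 hE h3 h8 => ⟨S.t4e_of k hk hI h5.1 hE h3, S.t4u_of k hk h5.2 h3 h8⟩

/-- Kernel (consistency of the two skeletons): routed through the coarse skeleton's `thm4_all`, the refined leaves
give the same conclusion as `thm4R_all`. [cite: Balaban1985RegularSpaces, proof of Thm 4 pp.88–95] -/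
theorem Thm4SkeletonR.thm4_all_via_coarse (S : Thm4SkeletonR) (hP5e : ∀ k, S.P5e k) (hP5u : ∀ k, S.P5u k)
    (hE : ∀ k, S.E110 k) (hP3 : ∀ k, S.P3 k) (h8 : S.P8B7) : ∀ k, 1 ≤ k → S.T4e k ∧ S.T4u k :=
  S.toSkeleton.thm4_all (fun k => ⟨hP5e k, hP5u k⟩) hE hP3 h8

/-- Carrier extension (sub-cell B08 gen 7): the calculus of gauge transformations used on pp. 89–95 over a
`GFData` carrier.  `mul u′ u₁` = the composition u′u₁ (p. 89: "The composition u = u′u₁ of these two gauge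
transformations is the transformation we are looking for"), `one` = the transformation identically equal to 1,
`inv` = u⁻¹; the laws `one_mul`, `mul_inv_cancel` ((u₂u₁⁻¹)u₁ = u₂) and the ACTION LAWS `act_one` (U^{1⁻¹} = U) and
`act_mul` (U′^{(u′u₁)⁻¹} = (U′^{u₁⁻¹})^{u′⁻¹}; with u′u₁ = u₂ this is "U₁^{u′⁻¹} = U₂" of (1.112)).  Named
predicates: `H169 B₁ s U₀ U₁` = the bounds of (1.69), |A| < B₁s(L^jη)⁻¹, |∇^η_{U₀}A| < B₁s(L^jη)⁻² on Ω_j, with the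
law `h169_of_c136` (they are the first two clauses of (1.36)); `Reg7374 a U₀ u₁` = the regularity of u₁ with
constant a in the LEVEL-k form "(1.73), (1.74) with k instead of k − 1" (p. 95) — revision v5, census G-A23-1:
i.e. (1.73) for x_n ∈ Ω_n^{(n)}, n ≤ k − 1, and (1.74) for x_n ∈ B(x_{n+1}), x_{n+1} ∈ B^{j−n−1}(Λ_j),
n ≤ j − 1, j = 1, …, k on the HONEST sets Λ₀, …, Λ_k (with (1.29)_k: the Λ-class conditions (166)/(167) of [3]
on B^j(Λ_j) for every j ≤ k that Sect. D, p. 89, feeds to Proposition 10 of [3]), NOT the printed range of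
pp. 88–89 (j ≤ k − 1, "Λ_{k−1} ∪ B(Λ_k) as Λ_{k−1}"), which is the separate predicate `GaugeCalcL.RegPr` of
§ (iii-d) (identification law `GaugeCalcL.reg7374_iff`); `SmallLog c u′` = "u′ = e^{iλ}, |λ|, |Dλ|₍₋₁₎ < c" (the
domain (1.109)), with `smallLog_one` (λ = 0 for u′ = 1); `Restricted68 U₀ u₁` = the inductive condition (1.68),
with the PRINTED implication `restricted_of_68` : (1.68) ⇒ (1.29)_k (p. 90, "Of course (R₀u₁‾^{k−1})(x) = 1 for
x ∈ B(Λ_k) implies (R₀u₁‾^k)(y) = 1 for y ∈ Λ_k, hence u₁ satisfies the conditions (1.29)").  The converse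
(1.29)_k ⇒ (1.68) is NOT a law (`toy_129_not_68`).  Nothing of the paper is asserted: an instance must supply the
group structure and prove the five laws. [cite: Balaban1985RegularSpaces, (1.68)–(1.69) p.88 + (1.78) p.90 + (1.109) p.94 + (1.112) p.95] -/
structure GaugeCalc (X : GFData) where
  mul : X.GT → X.GT → X.GT
  one : X.GT
  inv : X.GT → X.GT
  one_mul : ∀ u, mul one u = u
  mul_inv_cancel : ∀ u₁ u₂, mul (mul u₂ (inv u₁)) u₁ = u₂
  act_one : ∀ U, X.act U one = U
  act_mul : ∀ U u₁ u', X.act U (mul u' u₁) = X.act (X.act U u₁) u'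
  H169 : ℝ → ℝ → X.Cfg → X.Pert → Prop
  h169_of_c136 : ∀ B₁ B₂ s U₀ U₁, X.C136 B₁ B₂ s U₀ U₁ → H169 B₁ s U₀ U₁
  Reg7374 : ℝ → X.Cfg → X.GT → Prop
  SmallLog : ℝ → X.GT → Prop
  smallLog_one : ∀ c, 0 < c → SmallLog c one
  Restricted68 : X.Cfg → X.GT → Prop
  restricted_of_68 : ∀ U₀ u, Restricted68 U₀ u → X.Restricted U₀ u

/-- **Proposition 5, uniqueness half, in the REPAIRED hypothesis form** (census G-adv8-13; p. 94 (1.109) with "the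
configuration u₁ determined by U₁ and satisfying (1.68), (1.73), (1.74)" read as "… satisfying (1.29)_k and
(1.73), (1.74) with k instead of k − 1", cf. (1.78) p. 90 — revision v5, census G-A23-1: v4's gloss "which is what
pp. 90–94 use" is withdrawn as stated; pp. 90–94 prove this form when Sects. D–E are run on the honest level-k
sets, the regularity binder `G.Reg7374` being the LEVEL-k form, see `GaugeCalc` and § (iii-d)): for α₀ + α₁ ≤ c₂,
for every U₀, U′ and every u₁ satisfying (1.29)_k whose U₁ = U′^{u₁⁻¹} obeys the bounds (1.69) with constant B₁
and which obeys (1.73)–(1.74) at level k with constant a(α₀ + α₁), any two u′, u″ in the domain (1.109)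
("|λ|, |Dλ|₍₋₁₎ < c₃") solving "the problem described in
Proposition 5" — R₀u′u₁‾^j = 1 on Λ_j, j = 0, …, k (i.e. u′u₁ satisfies (1.29)_k, (1.107)/(1.78)) and the Landau
condition RD*(1/(iη)) log U₁^{u′⁻¹} = 0 ((1.107), = (1.38) for U₁^{u′⁻¹}) — coincide.  The thresholds c₂, c₃ and
the constants B₁, a are parameters ("positive constants c₂, c₃, depending on d and L only").  The analytic content
(fixed point + the onto step G-B8-05) is certified elsewhere (`…B8SectE`, `…B8Prop5Repaired`); this is the
STATEMENT in the form the p. 95 application needs. [cite: Balaban1985RegularSpaces, Prop. 5 (1.109) p.94 + (1.78) p.90] -/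
def Prop5UniqueR (c₂ c₃ B₁ a : ℝ) (X : GFData) (G : GaugeCalc X) : Prop :=
  ∀ α₀ α₁ : ℝ, 0 < α₀ → 0 < α₁ → α₀ + α₁ ≤ c₂ →
    ∀ U₀ : X.Cfg, ∀ U' : X.Pert, ∀ u₁ : X.GT,
      X.Restricted U₀ u₁ → G.H169 B₁ (α₀ + α₁) U₀ (X.act U' u₁) → G.Reg7374 (a * (α₀ + α₁)) U₀ u₁ →
      ∀ u' u'' : X.GT, G.SmallLog c₃ u' → G.SmallLog c₃ u'' →
        X.Restricted U₀ (G.mul u' u₁) → X.Landau U₀ (X.act (X.act U' u₁) u') →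
        X.Restricted U₀ (G.mul u'' u₁) → X.Landau U₀ (X.act (X.act U' u₁) u'') → u' = u''

/-- Proposition 5, uniqueness half, with the PRINTED hypothesis (1.68) on u₁ (p. 94 verbatim: "for the
configuration u₁ determined by U₁ and satisfying (1.68), (1.73), (1.74) … Such a configuration u′ is unique in the
domain |λ|, |Dλ|₍₋₁₎ < c₃. (1.109)"); otherwise identical to `Prop5UniqueR` — in particular (revision v5, census
G-A23-1) it keeps the LEVEL-k regularity binder `Reg7374`, so it is a HYBRID of the printed gauge-condition clause
with the level-k regularity clause; the fully printed hypothesis list, with (1.73)–(1.74) in the printed ranges,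
is `Prop5UniquePrintedPr` of § (iii-d), equivalent to this one under the range laws of `GaugeCalcL`
(`prop5UniquePrintedPr_iff_printed68`).  This is the form that does NOT cover the p. 95 application (census
G-adv8-13). [cite: Balaban1985RegularSpaces, Prop. 5 (1.109) p.94] -/
def Prop5UniquePrinted68 (c₂ c₃ B₁ a : ℝ) (X : GFData) (G : GaugeCalc X) : Prop :=
  ∀ α₀ α₁ : ℝ, 0 < α₀ → 0 < α₁ → α₀ + α₁ ≤ c₂ →
    ∀ U₀ : X.Cfg, ∀ U' : X.Pert, ∀ u₁ : X.GT,
      G.Restricted68 U₀ u₁ → G.H169 B₁ (α₀ + α₁) U₀ (X.act U' u₁) → G.Reg7374 (a * (α₀ + α₁)) U₀ u₁ →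
      ∀ u' u'' : X.GT, G.SmallLog c₃ u' → G.SmallLog c₃ u'' →
        X.Restricted U₀ (G.mul u' u₁) → X.Landau U₀ (X.act (X.act U' u₁) u') →
        X.Restricted U₀ (G.mul u'' u₁) → X.Landau U₀ (X.act (X.act U' u₁) u'') → u' = u''

/-- Kernel: the repaired uniqueness statement IMPLIES the printed-(1.68) one, through the printed implication (1.68) ⇒
(1.29)_k of p. 90 (`restricted_of_68`) — on the gauge-condition clause the repair weakens a hypothesis and does
not change the proposition's content on the inductive u₁ (revision v5, census G-A23-1: both sides here carry the
level-k regularity binder; with the printed RANGE of (1.73)–(1.74) on the right the implication needs in addition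
the law `GaugeCalcL.lev_of_68`, § (iii-d) `prop5UniquePrintedPr_of_R`). [cite: Balaban1985RegularSpaces, (1.78) p.90] -/
theorem prop5UniquePrinted68_of_R {c₂ c₃ B₁ a : ℝ} {X : GFData} {G : GaugeCalc X}
    (h : Prop5UniqueR c₂ c₃ B₁ a X G) : Prop5UniquePrinted68 c₂ c₃ B₁ a X G := by
  intro α₀ α₁ h0 h1 hs U₀ U' u₁ h68 h69 hreg u' u'' hs' hs'' hr' hl' hr'' hl''
  exact h α₀ α₁ h0 h1 hs U₀ U' u₁ (G.restricted_of_68 U₀ u₁ h68) h69 hreg u' u'' hs' hs'' hr' hl' hr'' hl''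

/-- Kernel (what the p. 95 quotation of Proposition 5 presupposes): the PRINTED uniqueness statement yields the
repaired one — the form applied at p. 95 to a level-k solution u₁ — GIVEN the converse implication
(1.29)_k ⇒ (1.68) as an extra hypothesis `hconv`.  That converse is not in the paper and fails at the level of
the constraints' shape (`toy_129_not_68`); the paper's way out is that pp. 90–94 prove `Prop5UniqueR` directly
once Sects. D–E are run on the honest level-k sets (census G-adv8-13, repair; G-A23-1, § (iii-d)). [cite: Balaban1985RegularSpaces, Prop. 5 p.94 + proof of Thm 4 p.95] -/
theorem prop5UniqueR_of_printed68 {c₂ c₃ B₁ a : ℝ} {X : GFData} {G : GaugeCalc X}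
    (hconv : ∀ U₀ u, X.Restricted U₀ u → G.Restricted68 U₀ u)
    (h : Prop5UniquePrinted68 c₂ c₃ B₁ a X G) : Prop5UniqueR c₂ c₃ B₁ a X G := by
  intro α₀ α₁ h0 h1 hs U₀ U' u₁ h29 h69 hreg u' u'' hs' hs'' hr' hl' hr'' hl''
  exact h α₀ α₁ h0 h1 hs U₀ U' u₁ (hconv U₀ u₁ h29) h69 hreg u' u'' hs' hs'' hr' hl' hr'' hl''

/-- Shape-level TOY witness (sub-cell; not the averaging (64)–(87) of [3], which is multiplicative and block-weighted
— only the shape "one block constraint on L^d sites" is modelled): d = 1, L = 2, k = 1, additive toy group ℤ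
(λ = log u), fine lattice Ω₀ = {0, 1, 2, 3}, Ω₁ = the block {2, 3}, Λ₀ = {0, 1}, Λ₁ = {the block}; (1.29)₁ reads
"u = 0 on Λ₀ and the block mean of u over {2, 3} vanishes", (1.68) at k = 1 (j = k − 1 = 0, Λ₀ ∪ B(Λ₁) = Ω₀) reads
"u = 0 everywhere" (consistent with p. 89, "For k = 1 we can simply take u₁ = 1").  The configuration
u = (0, 0, 1, −1) satisfies the first and not the second: (1.29)_k ⇏ (1.68), decided by the kernel.  (The printed
direction (1.68) ⇒ (1.29)_k holds in the toy trivially: `toy_68_implies_129`.) [folklore] -/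
theorem toy_129_not_68 :
    ∃ u : Fin 4 → ℤ, (u 0 = 0 ∧ u 1 = 0 ∧ u 2 + u 3 = 0) ∧ ¬ (∀ y : Fin 4, u y = 0) :=
  ⟨![0, 0, 1, -1], by decide, by decide⟩

/-- The printed direction of p. 90 in the same toy: "u = 0 everywhere" ((1.68) at k = 1) gives (1.29)₁. [folklore] -/
theorem toy_68_implies_129 (u : Fin 4 → ℤ) (h : ∀ y : Fin 4, u y = 0) :
    u 0 = 0 ∧ u 1 = 0 ∧ u 2 + u 3 = 0 := by
  refine ⟨h 0, h 1, ?_⟩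
  rw [h 2, h 3]; rfl

/-- The EXISTENCE clause of Theorem 4 (p. 88) with threshold c₁: under (1.33), (1.34), (1.66) with α₀ + α₁ ≤ c₁
there is a u with (1.29) such that U₁ = U′^{u⁻¹} satisfies (1.37), (1.38), (1.62). [cite: Balaban1985RegularSpaces, Thm 4 p.88] -/
def Thm4ExistsBody (c₁ B₁' : ℝ) (fam : I → GFData) : Prop :=
  ∀ i : I, ∀ α₀ α₁ : ℝ, 0 < α₀ → 0 < α₁ → α₀ + α₁ ≤ c₁ →
    ∀ U₀ : (fam i).Cfg, ∀ U' : (fam i).Pert,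
      (fam i).InA α₀ U₀ → (fam i).Reg335 α₀ U₀ → (fam i).InAAx α₀ U₀ U' → (fam i).avgClose166 α₁ U₀ U' →
        ∃ u : (fam i).GT, (fam i).Restricted U₀ u ∧
          (fam i).C137 α₁ U₀ ((fam i).act U' u) ∧ (fam i).Landau U₀ ((fam i).act U' u) ∧
            (fam i).C162 B₁' (α₀ + α₁) U₀ ((fam i).act U' u)

/-- The UNIQUENESS clause of Theorem 4 (p. 88, "exactly one"; proof p. 95) with threshold c₁: under (1.33), (1.34),
(1.66) with α₀ + α₁ ≤ c₁, two gauge transformations with (1.29) whose U′^{u⁻¹} satisfy (1.37), (1.38), (1.62)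
coincide. [cite: Balaban1985RegularSpaces, Thm 4 p.88 + proof p.95] -/
def Thm4UniqueBody (c₁ B₁' : ℝ) (fam : I → GFData) : Prop :=
  ∀ i : I, ∀ α₀ α₁ : ℝ, 0 < α₀ → 0 < α₁ → α₀ + α₁ ≤ c₁ →
    ∀ U₀ : (fam i).Cfg, ∀ U' : (fam i).Pert,
      (fam i).InA α₀ U₀ → (fam i).Reg335 α₀ U₀ → (fam i).InAAx α₀ U₀ U' → (fam i).avgClose166 α₁ U₀ U' →
        ∀ u₁ u₂ : (fam i).GT,
          (fam i).Restricted U₀ u₁ → (fam i).C137 α₁ U₀ ((fam i).act U' u₁) →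
            (fam i).Landau U₀ ((fam i).act U' u₁) → (fam i).C162 B₁' (α₀ + α₁) U₀ ((fam i).act U' u₁) →
          (fam i).Restricted U₀ u₂ → (fam i).C137 α₁ U₀ ((fam i).act U' u₂) →
            (fam i).Landau U₀ ((fam i).act U' u₂) → (fam i).C162 B₁' (α₀ + α₁) U₀ ((fam i).act U' u₂) →
          u₁ = u₂

/-- Kernel: "exactly one" = existence ∧ uniqueness, clause by clause (`Thm4Body` ↔ `Thm4ExistsBody` ∧
`Thm4UniqueBody` at the same threshold). [folklore] -/
theorem thm4Body_iff_halves (c₁ B₁' : ℝ) (fam : I → GFData) :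
    Thm4Body c₁ B₁' fam ↔ Thm4ExistsBody c₁ B₁' fam ∧ Thm4UniqueBody c₁ B₁' fam := by
  constructor
  · intro h
    refine ⟨fun i α₀ α₁ h0 h1 hs U₀ U' hA hR hAx hcl => ?_, fun i α₀ α₁ h0 h1 hs U₀ U' hA hR hAx hcl => ?_⟩
    · obtain ⟨u, hu, ⟨h37, h38, h62⟩, -⟩ := h i α₀ α₁ h0 h1 hs U₀ U' hA hR hAx hcl
      exact ⟨u, hu, h37, h38, h62⟩
    · obtain ⟨u, -, -, huniq⟩ := h i α₀ α₁ h0 h1 hs U₀ U' hA hR hAx hcl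
      intro u₁ u₂ hr₁ h37₁ h38₁ h62₁ hr₂ h37₂ h38₂ h62₂
      rw [huniq u₁ hr₁ h37₁ h38₁ h62₁, huniq u₂ hr₂ h37₂ h38₂ h62₂]
  · rintro ⟨hex, hun⟩ i α₀ α₁ h0 h1 hs U₀ U' hA hR hAx hcl
    obtain ⟨u, hu, h37, h38, h62⟩ := hex i α₀ α₁ h0 h1 hs U₀ U' hA hR hAx hcl
    exact ⟨u, hu, ⟨h37, h38, h62⟩, fun u' hu' h37' h38' h62' =>
      hun i α₀ α₁ h0 h1 hs U₀ U' hA hR hAx hcl u' u hu' h37' h38' h62' hu h37 h38 h62⟩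

/-- Kernel: Theorem 4 as printed (`Thm4Printed`) from its two halves at possibly different thresholds
(c₁ := min c c′). [folklore] -/
theorem thm4Printed_of_halves {B₁' c c' : ℝ} {fam : I → GFData} (hc : 0 < c) (hc' : 0 < c')
    (hex : Thm4ExistsBody c B₁' fam) (hun : Thm4UniqueBody c' B₁' fam) : Thm4Printed B₁' fam := by
  refine (thm4Printed_iff B₁' fam).2 ⟨min c c', lt_min hc hc', (thm4Body_iff_halves _ _ _).2 ⟨?_, ?_⟩⟩
  · intro i α₀ α₁ h0 h1 hs
    exact hex i α₀ α₁ h0 h1 (hs.trans (min_le_left _ _))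
  · intro i α₀ α₁ h0 h1 hs
    exact hun i α₀ α₁ h0 h1 (hs.trans (min_le_right _ _))

/-- Kernel (the smallness schedule of the uniqueness half, "For α₀ + α₁ sufficiently small the assumptions of this
proposition are satisfied", p. 95, made explicit): given the thresholds c of Proposition 3, c₂ of Proposition 5 and
c₈ of the Prop.-8-of-[3] step, B′₁ > 0 and C₂ ≥ 0, there is c₁ > 0 such that α₀ + α₁ ≤ c₁ forces α₀ + α₁ ≤ c₂,
α₀ + α₁ ≤ c₈ and the applicability of Proposition 3 at (α₀, α₁, α₂ = B′₁(α₀ + α₁)) including (1.61) — obtained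
from `thm2_schedule_exists` by monotonicity of (1.61) in α₂. [cite: Balaban1985RegularSpaces, (1.61)–(1.64) pp.86–87 + p.95] -/
theorem thm4u_schedule_exists {d c c₂ c₈ B₁' C₂ : ℝ} (hd : 0 ≤ d) (hc : 0 < c) (hc₂ : 0 < c₂) (hc₈ : 0 < c₈)
    (hB : 0 < B₁') (hC₂ : 0 ≤ C₂) :
    ∃ c₁ : ℝ, 0 < c₁ ∧ ∀ α₀ α₁ : ℝ, 0 < α₀ → 0 < α₁ → α₀ + α₁ ≤ c₁ →
      α₀ + α₁ ≤ c₂ ∧ α₀ + α₁ ≤ c₈ ∧ α₀ ≤ c ∧ α₁ ≤ c ∧ B₁' * (α₀ + α₁) ≤ c ∧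
      2 * (B₁' * (α₀ + α₁)) ^ 2 + 20 * d * α₀ * (B₁' * (α₀ + α₁)) + 2 * C₂ * (B₁' * (α₀ + α₁)) ^ 2 ≤
        α₀ + α₁ := by
  obtain ⟨c₁, hc₁, H⟩ :=
    thm2_schedule_exists (d := d) (c₀ := 1) (c₃ := c) (c₄ := min c₂ c₈) hd one_pos hc (lt_min hc₂ hc₈) hB hC₂
  refine ⟨c₁, hc₁, fun α₀ α₁ h0 h1 hs => ?_⟩
  obtain ⟨-, e4, e3a, e3b, e3c, e61⟩ := H α₀ α₁ h0 h1 hs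
  have hss' : α₀ + α₁ ≤ α₀ + (11 * d ^ 2 * α₀ + α₁) := by nlinarith [sq_nonneg d, h0.le]
  have hα₂ : B₁' * (α₀ + α₁) ≤ B₁' * (α₀ + (11 * d ^ 2 * α₀ + α₁)) := mul_le_mul_of_nonneg_left hss' hB.le
  have hα₂0 : 0 ≤ B₁' * (α₀ + α₁) := by positivity
  refine ⟨hss'.trans (e4.trans (min_le_left _ _)), hss'.trans (e4.trans (min_le_right _ _)), e3a, e3b,
    hα₂.trans e3c, ?_⟩
  have hsq : (B₁' * (α₀ + α₁)) ^ 2 ≤ (B₁' * (α₀ + (11 * d ^ 2 * α₀ + α₁))) ^ 2 := pow_le_pow_left₀ hα₂0 hα₂ 2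
  have hprod : α₀ * (B₁' * (α₀ + α₁)) ≤ α₀ * (B₁' * (α₀ + (11 * d ^ 2 * α₀ + α₁))) :=
    mul_le_mul_of_nonneg_left hα₂ h0.le
  nlinarith [hsq, hprod, mul_le_mul_of_nonneg_left hprod (by positivity : (0:ℝ) ≤ 20 * d),
    mul_le_mul_of_nonneg_left hsq hC₂]

/-- **The uniqueness half of Theorem 4 from the REPAIRED Proposition 5** — the p. 95 paragraph kernel-checked over
the carrier (census G-adv8-13).  Given two level-k solutions u₁, u₂ (each with (1.29)_k and (1.37), (1.38), (1.62)
for U′^{uᵢ⁻¹}): Proposition 3 at level k (`hP3`; hypotheses (1.40) from (1.33) and the gauge invariance of 𝔄_k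
`hginv`, (1.41) with α₂ = B′₁(α₀ + α₁) from (1.62) by `hmono162`, (1.42) = (1.38) + (1.37)) gives (1.36), hence
(1.69), for U₁ = U′^{u₁⁻¹} with B₁ = 5dLB₀ (`GaugeCalc.h169_of_c136`); `hReg` = "(1.73), (1.74) with k instead of
k − 1" for the level-k solution u₁ (the level-k re-run of the derivation (1.70)–(1.74), p. 88, with (1.62), B′₁,
for (1.69) — a step the paper does not print for u₁, revision v5 / census G-A23-1, named `Rerun7074AtK` in
§ (iii-d); it is the individual Λ_k-membership Proposition 8 of [3] presupposes); `hP8` = "This implies that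
u′ = u₂u₁⁻¹ satisfies the regularity conditions (1.73), (1.74) with k instead of k − 1 and with a worse constant.
This follows from Proposition 8 of [3]" read as: λ = (1/i) log u₂u₁⁻¹ lies in the domain (1.109) for α₀ + α₁ ≤ c₈
— both hypothesis SHAPES, not re-proved; then u′ = u₂u₁⁻¹ and 1 both solve the problem of Proposition 5 for
(U₁, u₁) ((1.112): R₀u′u₁‾^j = 1 on Λ_j from (1.29)_k of u₂, U₁^{u′⁻¹} = U₂ in the Landau gauge; 1 because "U₁
satisfies the same conditions as U₂"), and `Prop5UniqueR` — applicable because u₁ IS (1.29)_k-restricted, which is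
all the repaired hypothesis asks — gives u′ = 1, i.e. u₁ = u₂.  With the PRINTED hypothesis (1.68) in place of
(1.29)_k the same script does not type-check (u₁ is not known to satisfy (1.68); `prop5UniqueR_of_printed68` names
the missing converse).  Threshold c₁ from `thm4u_schedule_exists`. [cite: Balaban1985RegularSpaces, proof of Thm 4 (1.112) p.95] -/
theorem thm4Unique_of_prop5R (d : ℕ) (L C₂ B₁' : ℝ) (inp : B9Inputs) (B₀β : ℝ) (fam : I → GFData2)
    (G : ∀ i, GaugeCalc (fam i).toGFData) {c c₂ c₃ c₈ a : ℝ}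
    (hd : 1 ≤ d) (hL : 0 < L) (hC₂ : 0 ≤ C₂) (hB₁' : 5 * d * L * inp.B₀ ≤ B₁')
    (hc : 0 < c) (hc₂ : 0 < c₂) (hc₃ : 0 < c₃) (hc₈ : 0 < c₈)
    (hP3 : Prop3Body c d L C₂ inp B₀β fam)
    (hP5u : ∀ i, Prop5UniqueR c₂ c₃ (5 * d * L * inp.B₀) a (fam i).toGFData (G i))
    (hginv : ∀ i α₀ (U₀ : (fam i).Cfg) (U' : (fam i).Pert) (u : (fam i).GT),
      (fam i).InAAx α₀ U₀ U' → (fam i).InAPair α₀ U₀ ((fam i).act U' u))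
    (hmono162 : ∀ i b s b' s' (U₀ : (fam i).Cfg) (U₁ : (fam i).Pert), b * s ≤ b' * s' →
      (fam i).C162 b s U₀ U₁ → (fam i).C162 b' s' U₀ U₁)
    (hReg : ∀ i α₀ α₁ (U₀ : (fam i).Cfg) (U' : (fam i).Pert) (u₁ : (fam i).GT), 0 < α₀ → 0 < α₁ →
      α₀ + α₁ ≤ c₈ → (fam i).InA α₀ U₀ → (fam i).InAAx α₀ U₀ U' → (fam i).Restricted U₀ u₁ →
      (fam i).C162 B₁' (α₀ + α₁) U₀ ((fam i).act U' u₁) → (G i).Reg7374 (a * (α₀ + α₁)) U₀ u₁)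
    (hP8 : ∀ i α₀ α₁ (U₀ : (fam i).Cfg) (U' : (fam i).Pert) (u₁ u₂ : (fam i).GT), 0 < α₀ → 0 < α₁ →
      α₀ + α₁ ≤ c₈ → (fam i).InA α₀ U₀ → (fam i).InAAx α₀ U₀ U' →
      (fam i).Restricted U₀ u₁ → (fam i).Restricted U₀ u₂ →
      (fam i).C162 B₁' (α₀ + α₁) U₀ ((fam i).act U' u₁) → (fam i).C162 B₁' (α₀ + α₁) U₀ ((fam i).act U' u₂) →
      (G i).SmallLog c₃ ((G i).mul u₂ ((G i).inv u₁))) :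
    ∃ c₁ : ℝ, 0 < c₁ ∧ Thm4UniqueBody c₁ B₁' (fun i => (fam i).toGFData) := by
  have hd' : (0 : ℝ) ≤ d := by positivity
  have hB₁pos : 0 < 5 * d * L * inp.B₀ := by
    have := inp.B₀_pos
    have : (1 : ℝ) ≤ d := by exact_mod_cast hd
    positivity
  have hB₁'pos : 0 < B₁' := lt_of_lt_of_le hB₁pos hB₁'
  obtain ⟨c₁, hc₁, sched⟩ := thm4u_schedule_exists hd' hc hc₂ hc₈ hB₁'pos hC₂
  refine ⟨c₁, hc₁, ?_⟩
  intro i α₀ α₁ h0 h1 hs U₀ U' hA hR335 hAx h166 u₁ u₂ hr₁ h37₁ h38₁ h62₁ hr₂ h37₂ h38₂ h62₂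
  obtain ⟨e2, e8, e3a, e3b, e3c, e61⟩ := sched α₀ α₁ h0 h1 hs
  -- Step 1 (Proposition 3 at level k): U₁ = U′^{u₁⁻¹} obeys (1.36) with B₁ = 5dLB₀, hence (1.69).
  have hα₂pos : 0 < B₁' * (α₀ + α₁) := by positivity
  have h41 : (fam i).C162 1 (B₁' * (α₀ + α₁)) U₀ ((fam i).act U' u₁) :=
    hmono162 i B₁' (α₀ + α₁) 1 (B₁' * (α₀ + α₁)) U₀ _ (by rw [one_mul]) h62₁
  obtain ⟨h36, -⟩ := hP3 i α₀ α₁ (B₁' * (α₀ + α₁)) h0 e3a h1 e3b hα₂pos e3c e61 U₀ ((fam i).act U' u₁)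
    hA hR335 (hginv i α₀ U₀ U' u₁ hAx) h41 h38₁ h37₁
  have h169 : (G i).H169 (5 * d * L * inp.B₀) (α₀ + α₁) U₀ ((fam i).act U' u₁) :=
    (G i).h169_of_c136 _ _ _ _ _ h36
  -- Step 2: regularity of u₁ "with k instead of k − 1"; smallness of λ for u′ = u₂u₁⁻¹ (Prop. 8 of [3]) and for 1.
  have hreg := hReg i α₀ α₁ U₀ U' u₁ h0 h1 e8 hA hAx hr₁ h62₁
  have hsm := hP8 i α₀ α₁ U₀ U' u₁ u₂ h0 h1 e8 hA hAx hr₁ hr₂ h62₁ h62₂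
  have hsm1 := (G i).smallLog_one c₃ hc₃
  -- Step 3: u′ = u₂u₁⁻¹ and 1 both solve "the problem described in Proposition 5" for (U₁, u₁) ((1.112)).
  have hsol_r : (fam i).Restricted U₀ ((G i).mul ((G i).mul u₂ ((G i).inv u₁)) u₁) := by
    rw [(G i).mul_inv_cancel]; exact hr₂
  have hsol_l : (fam i).Landau U₀ ((fam i).act ((fam i).act U' u₁) ((G i).mul u₂ ((G i).inv u₁))) := by
    rw [← (G i).act_mul, (G i).mul_inv_cancel]; exact h38₂
  have hone_r : (fam i).Restricted U₀ ((G i).mul (G i).one u₁) := by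
    rw [(G i).one_mul]; exact hr₁
  have hone_l : (fam i).Landau U₀ ((fam i).act ((fam i).act U' u₁) (G i).one) := by
    rw [(G i).act_one]; exact h38₁
  -- Step 4: the repaired Proposition 5 applies to the (1.29)_k-restricted u₁: u′ = 1, hence u₂ = u₁.
  have hu' : (G i).mul u₂ ((G i).inv u₁) = (G i).one :=
    hP5u i α₀ α₁ h0 h1 e2 U₀ U' u₁ hr₁ h169 hreg _ _ hsm hsm1 hsol_r hsol_l hone_r hone_l
  have h := (G i).mul_inv_cancel u₁ u₂
  rw [hu', (G i).one_mul] at h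
  exact h

/-- Kernel (assembly): Theorem 4 as printed from an existence half (threshold c_e, e.g. the induction
`Thm4SkeletonR` through `P5e`) and the uniqueness half derived above from the repaired Proposition 5. [cite: Balaban1985RegularSpaces, Thm 4 p.88 + proof pp.94–95] -/
theorem thm4Printed_of_exists_prop5R (d : ℕ) (L C₂ B₁' : ℝ) (inp : B9Inputs) (B₀β : ℝ) (fam : I → GFData2)
    (G : ∀ i, GaugeCalc (fam i).toGFData) {c c₂ c₃ c₈ a cₑ : ℝ}
    (hd : 1 ≤ d) (hL : 0 < L) (hC₂ : 0 ≤ C₂) (hB₁' : 5 * d * L * inp.B₀ ≤ B₁')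
    (hc : 0 < c) (hc₂ : 0 < c₂) (hc₃ : 0 < c₃) (hc₈ : 0 < c₈) (hcₑ : 0 < cₑ)
    (hex : Thm4ExistsBody cₑ B₁' (fun i => (fam i).toGFData))
    (hP3 : Prop3Body c d L C₂ inp B₀β fam)
    (hP5u : ∀ i, Prop5UniqueR c₂ c₃ (5 * d * L * inp.B₀) a (fam i).toGFData (G i))
    (hginv : ∀ i α₀ (U₀ : (fam i).Cfg) (U' : (fam i).Pert) (u : (fam i).GT),
      (fam i).InAAx α₀ U₀ U' → (fam i).InAPair α₀ U₀ ((fam i).act U' u))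
    (hmono162 : ∀ i b s b' s' (U₀ : (fam i).Cfg) (U₁ : (fam i).Pert), b * s ≤ b' * s' →
      (fam i).C162 b s U₀ U₁ → (fam i).C162 b' s' U₀ U₁)
    (hReg : ∀ i α₀ α₁ (U₀ : (fam i).Cfg) (U' : (fam i).Pert) (u₁ : (fam i).GT), 0 < α₀ → 0 < α₁ →
      α₀ + α₁ ≤ c₈ → (fam i).InA α₀ U₀ → (fam i).InAAx α₀ U₀ U' → (fam i).Restricted U₀ u₁ →
      (fam i).C162 B₁' (α₀ + α₁) U₀ ((fam i).act U' u₁) → (G i).Reg7374 (a * (α₀ + α₁)) U₀ u₁)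
    (hP8 : ∀ i α₀ α₁ (U₀ : (fam i).Cfg) (U' : (fam i).Pert) (u₁ u₂ : (fam i).GT), 0 < α₀ → 0 < α₁ →
      α₀ + α₁ ≤ c₈ → (fam i).InA α₀ U₀ → (fam i).InAAx α₀ U₀ U' →
      (fam i).Restricted U₀ u₁ → (fam i).Restricted U₀ u₂ →
      (fam i).C162 B₁' (α₀ + α₁) U₀ ((fam i).act U' u₁) → (fam i).C162 B₁' (α₀ + α₁) U₀ ((fam i).act U' u₂) →
      (G i).SmallLog c₃ ((G i).mul u₂ ((G i).inv u₁))) :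
    Thm4Printed B₁' (fun i => (fam i).toGFData) := by
  obtain ⟨c₁, hc₁, hun⟩ :=
    thm4Unique_of_prop5R d L C₂ B₁' inp B₀β fam G hd hL hC₂ hB₁' hc hc₂ hc₃ hc₈ hP3 hP5u hginv hmono162 hReg hP8
  exact thm4Printed_of_halves hcₑ hc₁ hex hun

/-! ### (iii-d) Level-indexed regularity — which range of (1.73)–(1.74) each use of Proposition 5 consumes, and where (1.68) re-enters (census G-A23-1)

REVISION v5 (paper sub-cell B08 gen 8, 2026-08-18), APPEND-ONLY.  The cell's hostile cross-read adv1-g18 of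
§ (iii-c) (GAPS C-A23-1, objection G-A23-1) corrects a PROSE claim of REVISION v4 — that "(1.78), i.e. (1.29)_k
for u₁, is all that Sects. D–E use of (1.68)" and that the repair of G-adv8-13 changes "no display and no
constant" — and remarks (R2) that the predicate `GaugeCalc.Reg7374` carries no level index, so that p. 95's
"with k instead of k − 1" is invisible in the type.  This section makes the level visible and names the law by
which (1.68) re-enters.  Printed loci (renders re-read as images by the sub-cell):

* (1.73), p. 88 [PDF 14]: *"The same argument can be applied to the averages R₀u₁‾^n, and we get
  |(R₀u₁‾^n)(x_n) − 1| < 16dB₁(α₀ + α₁), x_n ∈ Ω_n^{(n)}. (1.73)"*; (1.74), p. 89 [PDF 15]: *"From (108) and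
  (1.71) we obtain also |(R₀u₁‾^n)⁻¹(x_{n+1})(R̄^n_{0,x_{n+1}}R₀u₀‾^n)(x_n) − 1| < 4dB₁(α₀ + α₁)L^{n+1−j} (1.74)
  for x_n ∈ B(x_{n+1}), x_{n+1} ∈ B^{j−n−1}(Λ_j), n = 0, …, j − 1, j = 1, …, k − 1 (we take Λ_{k−1}∪B(Λ_k) as
  Λ_{k−1})."* — both DERIVED (pp. 88–89, (1.70)–(1.72): "From (105) and (106) we have for x ∈ B^j(Λ_j)",
  "Using (130) and (1.69)") for the inductive u₁ from (1.68)–(1.69), i.e. through u₁'s gauge conditions.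
* Sect. D, p. 89 [PDF 15]: *"The estimates (1.75), (1.76) imply that u′ satisfies the regularity conditions
  (176), (177) [3] on Ω_j ⊂ T_{L^{−j}} with α₄ = 32dB₁(α₀ + α₁). The estimates (1.73), (1.74) together with the
  condition R₀u₁‾^j = 1 on Λ_j imply that u₁ satisfies (166), (167) [3] on B^j(Λ_j) ⊂ T_{L^{−j}} with
  α₃ = 16dB₁(α₀ + α₁), thus for α₀ + α₁ sufficiently small the assumptions of Proposition 10 are satisfied and
  we have the representation (213) and the bounds (214) [3]."*
* [3] = B7, p. 44 [PDF 28]: *"Λ_k(U₀, α₃) is a set of gauge transformations u defined on Ω, and satisfying the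
  conditions |(R₀u‾^j)(x_j) − 1| < α₃, x_j ∈ Ω^{(j)}, j = 0, 1, …, k, (166)
  |(R₀u‾^j)⁻¹(x_{j+1})(R̄^j_{0,x_{j+1}}R₀u‾^j)(x_j) − 1| < α₃L^{j+1}η, x_{j+1} ∈ Ω^{(j+1)}, x_j ∈ B(x_{j+1}),
  j = 0, 1, …, k − 1. (167)"*; p. 45 [PDF 29]: *"Proposition 8. If u₁, u₂ ∈ Λ_k(U₀, α₃) and α₃ is sufficiently
  small, i.e., α₃ ≦ c₆ for some c₆, then u = u₁u₂ ∈ Λ_k(U₀, 2α₃ + 2C₃α₃²) and we have (173)."*; p. 50 [PDF 34]: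
  *"Proposition 10. There exist positive constants C₄, C₅, c₆ such that for arbitrary configurations U₀, u′, u₁
  satisfying (52), (176), (177), (166), (167) with α₀, α₃, α₄ ≦ c₆ the bounds (203), (204) hold for j ≦ k."*

THE ACCOUNTING (sub-cell, confirming G-A23-1 on the renders).  Sects. D–E solve the equations (1.78), ũ′^j = 1 on
Λ_j for j = 0, …, k, through the representation (213)–(214) of [3], whose hypothesis (Proposition 10 of [3]) is:
u₁ in the Λ-class of [3] on B^j(Λ_j) with top level j, for EVERY j ≤ k — including j = k.  For j ≤ k − 1 this
is the printed (1.73)–(1.74) plus (1.29).  For j = k, on B^k(Λ_k): (166) at level k is (1.29)_k; (166) at the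
levels ≤ k − 1 is (1.73); (167) at the levels n ≤ k − 2 is (1.74) at j = k − 1 — whose printed range reaches
the Λ_k region ONLY through the convention "we take Λ_{k−1} ∪ B(Λ_k) as Λ_{k−1}", i.e. because the inductive u₁
obeys the level-(k − 1) gauge condition on B(Λ_k) (the last clause of (1.68)), from which (1.70)–(1.74) are
derived there via (106) of [3]; and (167) at the top pairs (x_k ∈ Λ_k, x_{k−1} ∈ B(x_k)) lies OUTSIDE the
printed range and holds for the inductive u₁ because both averages in it equal 1 by the same clause of (1.68).
So (1.68) enters Sects. D–E twice: as (1.29)_k (p. 90, (1.78)) AND as the source of u₁'s regularity on the Λ_k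
region.  For a LEVEL-k SOLUTION u₁ (the p. 95 application, census G-adv8-13) neither use is available from
(1.68): (1.29)_k is then a hypothesis of Theorem 4, and the regularity "(1.73), (1.74) with k instead of k − 1"
on the honest sets Λ₀, …, Λ_k must come from the level-k RE-RUN of (1.70)–(1.74) — (106) of [3] with k levels,
(130) of [3], and (1.62) (|A₁| < B′₁(α₀ + α₁)(L^jη)⁻¹ on Ω_j, j ≤ k) in place of (1.69) — a derivation the
paper does not print for u₁: p. 95 asserts the level-k conditions of u′ = u₂u₁⁻¹ only ("This follows from
Proposition 8 of [3]"), and Proposition 8's own hypothesis is u₁, u₂ ∈ Λ_k(U₀, α₃) INDIVIDUALLY — which is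
that re-run, applied to each solution.  It is absorbed by "For α₀ + α₁ sufficiently small the assumptions of
this proposition are satisfied"; no display of the paper changes its FORM, but the displays of Sects. D–E are
instantiated a second time, on the honest level-k sets (α₃ = 16dB′₁(α₀ + α₁), α₄ = 32dB′₁(α₀ + α₁)) — v4's
"No display and no constant of the paper changes" overstated this.  (The top pairs of (167) alone would not be
an independent gap: with L^kη = 1 that instance follows from (166) at level k − 1 up to replacing α₃ by
2α₃ + O(α₃²), R̄^{k−1}_{0,x_k} being a unitary transport; the substantive unprinted input is the level-k re-run
as a whole, in particular (1.74) on the Λ_k region for a u₁ that is not gauge-fixed by (1.68) there.)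

What this section records (typed skeleton, statement level; nothing of the paper asserted).  (1) `GaugeCalcL`
extends `GaugeCalc` by a LEVEL-INDEXED regularity predicate `RegLev m` ("(1.73), (1.74) with m in place of
k − 1", honest sets), the identification law `reg7374_iff` (the v4 predicate `Reg7374` IS the level-k
instance — so `Prop5UniqueR` and the binder `hReg` of `thm4Unique_of_prop5R` consume level k, as G-A23-1
requires), the PRINTED-range predicate `RegPr` ((1.73)–(1.74) of pp. 88–89: level k − 1 with the convention),
and three range laws: `regPr_of_lev` (level k ⇒ printed range: inclusion of ranges), `levPred_of_regPr`
(printed range ⇒ honest level k − 1: the convention only adds points) and `lev_of_68` ((1.68) ∧ printed range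
⇒ level k: the law BY WHICH (1.68) RE-ENTERS — the missing instances vanish identically for a u obeying
(1.68)); all with the same constant.  (2) `Prop5UniquePrintedPr` = Proposition 5's uniqueness clause with the
fully PRINTED hypothesis list "(1.68), (1.73), (1.74)" in the printed ranges; `prop5UniquePrintedPr_of_R`
(repaired ⇒ printed, using `restricted_of_68` AND `lev_of_68`), `prop5UniquePrintedPr_iff_printed68` (v4's
`Prop5UniquePrinted68` is the hybrid "(1.68) with level-k regularity", equivalent to the printed form under the
laws) and `prop5UniqueR_of_printedPr` (printed ⇒ repaired needs exactly the converse (1.29)_k ⇒ (1.68) of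
v4's `prop5UniqueR_of_printed68`; the regularity direction is the monotone one).  (3) `Rerun7074AtK` = the
binder `hReg` of `thm4Unique_of_prop5R` as a NAMED predicate — the unprinted level-k re-run for a
(1.29)_k-restricted u₁ — with `rerun_iff_level_k` (over `GaugeCalcL` it concludes level k by name) and
`thm4Unique_of_rerun`, the v4 derivation consuming it by name.  (4) `Thm4SkeletonL` = `Thm4SkeletonR` with
the re-run as an explicit leaf `R74 k` of the uniqueness branch (`t4u_of : P5u k → P3 k → R74 k → P8B7 →
T4u k`); forgetting it into the Prop.-8 leaf (`toSkeletonR`, P8B7 := P8B7 ∧ ∀ k, R74 k) recovers the v4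
skeleton, which therefore hid this step inside "Proposition 8 of [3]" exactly as p. 95 does.  Value = typed
skeleton making an unprinted step visible in the type + docfix, NOT summit progress; census C-B8-29,
DIVERGENCE D-b08-g8.1. -/

/-- Carrier extension (sub-cell B08 gen 8, census G-A23-1 V2): the calculus `GaugeCalc` with the regularity of
u₁ carried at a VISIBLE LEVEL.  `RegLev m a U₀ u` = the bounds "(1.73), (1.74) with m in place of k − 1" on the
HONEST sets, read with the single constant a = α₃ as Λ-class conditions of [3] (print: 16dB₁(α₀ + α₁) in
(1.73), 4dB₁(α₀ + α₁)L^{n+1−j} ≤ 16dB₁(α₀ + α₁)L^{n+1−j} in (1.74)): (1.73) for x_n ∈ Ω_n^{(n)}, n ≤ m, and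
(1.74) for x_n ∈ B(x_{n+1}), x_{n+1} ∈ B^{j−n−1}(Λ_j), n = 0, …, j − 1, j = 1, …, m.  For m = X.k this is
p. 95's "(1.73), (1.74) with k instead of k − 1" and, together with (1.29)_k, exactly the conditions (166)
(levels ≤ j), (167) (levels ≤ j − 1) of [3] on B^j(Λ_j) for every j ≤ k, α₃ = a — the input of Proposition 10
of [3] in Sect. D, p. 89.  `reg7374_iff` IDENTIFIES the v4 predicate `Reg7374` with the level-k instance (so
`Prop5UniqueR` and the binder `hReg` of `thm4Unique_of_prop5R` consume level k).  `RegPr a U₀ u` =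
(1.73)–(1.74) in the PRINTED ranges of pp. 88–89 (m = k − 1, "(we take Λ_{k−1} ∪ B(Λ_k) as Λ_{k−1})").
Range laws, each an inclusion of index sets or the vanishing of the missing instances, same constant:
`regPr_of_lev` — level k ⇒ printed (the level-k ranges contain the convention-extended level-(k − 1) ranges);
`levPred_of_regPr` — printed ⇒ honest level k − 1 (the convention only adds the points of B(Λ_k));
`lev_of_68` — (1.68) ∧ printed ⇒ level k: the instances missing from the printed range, (166) at level k on
Λ_k and (167) at the pairs x_k ∈ Λ_k, x_{k−1} ∈ B(x_k), have both averages equal to 1 under (1.68) (p. 90: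
"Of course (R₀u₁‾^{k−1})(x) = 1 for x ∈ B(Λ_k) implies (R₀u₁‾^k)(y) = 1 for y ∈ Λ_k"); THIS is the law by
which (1.68) re-enters the printed Proposition 5 (census G-A23-1).  Nothing of the paper is asserted: an
instance must define the predicates and prove the laws. [cite: Balaban1985RegularSpaces, (1.73) p.88 + (1.74) p.89 + Sect. D p.89 + proof of Thm 4 p.95] [cite: Balaban1985Averaging, (166)–(167) p.44] -/
structure GaugeCalcL (X : GFData) extends GaugeCalc X where
  RegLev : ℕ → ℝ → X.Cfg → X.GT → Prop
  reg7374_iff : ∀ a U₀ u, Reg7374 a U₀ u ↔ RegLev X.k a U₀ u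
  RegPr : ℝ → X.Cfg → X.GT → Prop
  regPr_of_lev : ∀ a U₀ u, RegLev X.k a U₀ u → RegPr a U₀ u
  levPred_of_regPr : ∀ a U₀ u, RegPr a U₀ u → RegLev (X.k - 1) a U₀ u
  lev_of_68 : ∀ a U₀ u, Restricted68 U₀ u → RegPr a U₀ u → RegLev X.k a U₀ u

/-- Kernel (the sandwich of ranges): level k ⇒ printed range ⇒ honest level k − 1; and for a u obeying (1.68)
the printed range gives back level k (`lev_of_68`), so on the inductive u₁ the three forms agree. [cite: Balaban1985RegularSpaces, (1.74) p.89] -/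
theorem GaugeCalcL.regLev_pred_of_reg7374 {X : GFData} (G : GaugeCalcL X) (a : ℝ) (U₀ : X.Cfg) (u : X.GT)
    (h : G.Reg7374 a U₀ u) : G.RegPr a U₀ u ∧ G.RegLev (X.k - 1) a U₀ u := by
  have hk : G.RegLev X.k a U₀ u := (G.reg7374_iff a U₀ u).1 h
  exact ⟨G.regPr_of_lev a U₀ u hk, G.levPred_of_regPr a U₀ u (G.regPr_of_lev a U₀ u hk)⟩

/-- Kernel: for a u obeying (1.68), printed-range regularity IS the v4 predicate `Reg7374` (level k) — the two
directions are `lev_of_68` and `regPr_of_lev`. [cite: Balaban1985RegularSpaces, (1.68) p.88 + (1.74) p.89 + (1.78) p.90] -/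
theorem GaugeCalcL.reg7374_iff_regPr_of_68 {X : GFData} (G : GaugeCalcL X) (a : ℝ) (U₀ : X.Cfg) (u : X.GT)
    (h68 : G.Restricted68 U₀ u) : G.Reg7374 a U₀ u ↔ G.RegPr a U₀ u :=
  ⟨fun h => G.regPr_of_lev a U₀ u ((G.reg7374_iff a U₀ u).1 h),
    fun h => (G.reg7374_iff a U₀ u).2 (G.lev_of_68 a U₀ u h68 h)⟩

/-- **Proposition 5, uniqueness half, with the fully PRINTED hypothesis list** (p. 94 [PDF 20], verbatim: *"for
an arbitrary configuration U₁ satisfying (1.69), and for the configuration u₁ determined by U₁ and satisfying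
(1.68), (1.73), (1.74) … Such a configuration u′ is unique in the domain |λ|, |Dλ|₍₋₁₎ < c₃. (1.109)"*), the
regularity clause now in the PRINTED ranges of pp. 88–89 (`GaugeCalcL.RegPr`: j ≤ k − 1, "Λ_{k−1} ∪ B(Λ_k) as
Λ_{k−1}") — otherwise binder for binder `Prop5UniquePrinted68` (which keeps the level-k `Reg7374`, a hybrid) and
`Prop5UniqueR` (which has (1.29)_k and level k).  This is the statement pp. 90–94 prove AS PRINTED, for the
inductive u₁. [cite: Balaban1985RegularSpaces, Prop. 5 (1.109) p.94] -/
def Prop5UniquePrintedPr (c₂ c₃ B₁ a : ℝ) (X : GFData) (G : GaugeCalcL X) : Prop :=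
  ∀ α₀ α₁ : ℝ, 0 < α₀ → 0 < α₁ → α₀ + α₁ ≤ c₂ →
    ∀ U₀ : X.Cfg, ∀ U' : X.Pert, ∀ u₁ : X.GT,
      G.Restricted68 U₀ u₁ → G.H169 B₁ (α₀ + α₁) U₀ (X.act U' u₁) → G.RegPr (a * (α₀ + α₁)) U₀ u₁ →
      ∀ u' u'' : X.GT, G.SmallLog c₃ u' → G.SmallLog c₃ u'' →
        X.Restricted U₀ (G.mul u' u₁) → X.Landau U₀ (X.act (X.act U' u₁) u') →
        X.Restricted U₀ (G.mul u'' u₁) → X.Landau U₀ (X.act (X.act U' u₁) u'') → u' = u''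

/-- Kernel: the REPAIRED uniqueness statement (level k, (1.29)_k) implies the fully PRINTED one — through BOTH
printed facts about the inductive u₁: (1.68) ⇒ (1.29)_k (p. 90, `restricted_of_68`) and (1.68) ∧ printed-range
(1.73)–(1.74) ⇒ level-k regularity (`lev_of_68`, where (1.68) re-enters; census G-A23-1).  So the repair is a
weakening of the gauge-condition clause TOGETHER WITH a re-reading of the regularity clause at level k, not a
pure weakening (corrects the v4 gloss). [cite: Balaban1985RegularSpaces, (1.78) p.90 + Sect. D p.89] -/
theorem prop5UniquePrintedPr_of_R {c₂ c₃ B₁ a : ℝ} {X : GFData} {G : GaugeCalcL X}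
    (h : Prop5UniqueR c₂ c₃ B₁ a X G.toGaugeCalc) : Prop5UniquePrintedPr c₂ c₃ B₁ a X G := by
  intro α₀ α₁ h0 h1 hs U₀ U' u₁ h68 h69 hregPr u' u'' hs' hs'' hr' hl' hr'' hl''
  exact h α₀ α₁ h0 h1 hs U₀ U' u₁ (G.restricted_of_68 U₀ u₁ h68) h69
    ((G.reg7374_iff _ U₀ u₁).2 (G.lev_of_68 _ U₀ u₁ h68 hregPr)) u' u'' hs' hs'' hr' hl' hr'' hl''

/-- Kernel: under the range laws the v4 hybrid `Prop5UniquePrinted68` ((1.68) with level-k regularity) and the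
fully printed `Prop5UniquePrintedPr` are EQUIVALENT — on a u₁ obeying (1.68) the two regularity forms coincide
(`reg7374_iff_regPr_of_68`). [cite: Balaban1985RegularSpaces, Prop. 5 (1.109) p.94] -/
theorem prop5UniquePrintedPr_iff_printed68 {c₂ c₃ B₁ a : ℝ} {X : GFData} (G : GaugeCalcL X) :
    Prop5UniquePrintedPr c₂ c₃ B₁ a X G ↔ Prop5UniquePrinted68 c₂ c₃ B₁ a X G.toGaugeCalc := by
  constructor
  · intro h α₀ α₁ h0 h1 hs U₀ U' u₁ h68 h69 hreg u' u'' hs' hs'' hr' hl' hr'' hl''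
    exact h α₀ α₁ h0 h1 hs U₀ U' u₁ h68 h69 ((G.reg7374_iff_regPr_of_68 _ U₀ u₁ h68).1 hreg)
      u' u'' hs' hs'' hr' hl' hr'' hl''
  · intro h α₀ α₁ h0 h1 hs U₀ U' u₁ h68 h69 hregPr u' u'' hs' hs'' hr' hl' hr'' hl''
    exact h α₀ α₁ h0 h1 hs U₀ U' u₁ h68 h69 ((G.reg7374_iff_regPr_of_68 _ U₀ u₁ h68).2 hregPr)
      u' u'' hs' hs'' hr' hl' hr'' hl''

/-- Kernel (what the p. 95 citation of the PRINTED Proposition 5 would need, complete form): the fully printed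
statement yields the repaired one GIVEN the converse (1.29)_k ⇒ (1.68) (`hconv`, not in the paper; shape-level
countermodel `toy_129_not_68`) — and nothing else: the regularity clause goes the monotone way (`regPr_of_lev`).
[cite: Balaban1985RegularSpaces, Prop. 5 p.94 + proof of Thm 4 p.95] -/
theorem prop5UniqueR_of_printedPr {c₂ c₃ B₁ a : ℝ} {X : GFData} {G : GaugeCalcL X}
    (hconv : ∀ U₀ u, X.Restricted U₀ u → G.Restricted68 U₀ u)
    (h : Prop5UniquePrintedPr c₂ c₃ B₁ a X G) : Prop5UniqueR c₂ c₃ B₁ a X G.toGaugeCalc := by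
  intro α₀ α₁ h0 h1 hs U₀ U' u₁ h29 h69 hreg u' u'' hs' hs'' hr' hl' hr'' hl''
  exact h α₀ α₁ h0 h1 hs U₀ U' u₁ (hconv U₀ u₁ h29) h69
    (G.regPr_of_lev _ U₀ u₁ ((G.reg7374_iff _ U₀ u₁).1 hreg)) u' u'' hs' hs'' hr' hl' hr'' hl''

/-- **The unprinted step of p. 95, named** (census G-A23-1; = the binder `hReg` of `thm4Unique_of_prop5R`):
for α₀ + α₁ ≤ c₈, every (1.29)_k-restricted u₁ whose U₁ = U′^{u₁⁻¹} obeys (1.62) with constant B′₁ (U₀ ∈ 𝔄_k(α₀),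
U′U₀ as in (1.34)) satisfies "(1.73), (1.74) with k instead of k − 1" (`Reg7374`, level k by `reg7374_iff`)
with constant a(α₀ + α₁) — the level-k RE-RUN of (1.70)–(1.74), p. 88 ((106) and (130) of [3], (1.62) for
(1.69), a = 16dB′₁): the individual input u₁, u₂ ∈ Λ_k(U₀, α₃) of Proposition 8 of [3] that p. 95 invokes
("This follows from Proposition 8 of [3]") without stating it for u₁.  A hypothesis SHAPE, not proved here.
[cite: Balaban1985RegularSpaces, (1.70)–(1.74) pp.88–89 + proof of Thm 4 p.95] [cite: Balaban1985Averaging, Prop. 8 p.45] -/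
def Rerun7074AtK (c₈ B₁' a : ℝ) (X : GFData) (G : GaugeCalc X) : Prop :=
  ∀ α₀ α₁ : ℝ, ∀ U₀ : X.Cfg, ∀ U' : X.Pert, ∀ u₁ : X.GT, 0 < α₀ → 0 < α₁ → α₀ + α₁ ≤ c₈ →
    X.InA α₀ U₀ → X.InAAx α₀ U₀ U' → X.Restricted U₀ u₁ → X.C162 B₁' (α₀ + α₁) U₀ (X.act U' u₁) →
    G.Reg7374 (a * (α₀ + α₁)) U₀ u₁

/-- Kernel: over `GaugeCalcL` the named re-run concludes LEVEL k by name (`RegLev X.k`), which is the form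
G-A23-1 asks the hypothesis to be stated in. [cite: Balaban1985RegularSpaces, proof of Thm 4 p.95] -/
theorem rerun_iff_level_k {c₈ B₁' a : ℝ} {X : GFData} (G : GaugeCalcL X) :
    Rerun7074AtK c₈ B₁' a X G.toGaugeCalc ↔
      ∀ α₀ α₁ : ℝ, ∀ U₀ : X.Cfg, ∀ U' : X.Pert, ∀ u₁ : X.GT, 0 < α₀ → 0 < α₁ → α₀ + α₁ ≤ c₈ →
        X.InA α₀ U₀ → X.InAAx α₀ U₀ U' → X.Restricted U₀ u₁ → X.C162 B₁' (α₀ + α₁) U₀ (X.act U' u₁) →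
        G.RegLev X.k (a * (α₀ + α₁)) U₀ u₁ := by
  constructor
  · intro h α₀ α₁ U₀ U' u₁ h0 h1 hs hA hAx hr h62
    exact (G.reg7374_iff _ U₀ u₁).1 (h α₀ α₁ U₀ U' u₁ h0 h1 hs hA hAx hr h62)
  · intro h α₀ α₁ U₀ U' u₁ h0 h1 hs hA hAx hr h62
    exact (G.reg7374_iff _ U₀ u₁).2 (h α₀ α₁ U₀ U' u₁ h0 h1 hs hA hAx hr h62)

/-- Kernel: the v4 derivation of Theorem 4's uniqueness clause with the unprinted level-k re-run consumed BY NAME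
(`Rerun7074AtK` for `hReg`); otherwise `thm4Unique_of_prop5R` verbatim. [cite: Balaban1985RegularSpaces, proof of Thm 4 (1.112) p.95] -/
theorem thm4Unique_of_rerun (d : ℕ) (L C₂ B₁' : ℝ) (inp : B9Inputs) (B₀β : ℝ) (fam : I → GFData2)
    (G : ∀ i, GaugeCalc (fam i).toGFData) {c c₂ c₃ c₈ a : ℝ}
    (hd : 1 ≤ d) (hL : 0 < L) (hC₂ : 0 ≤ C₂) (hB₁' : 5 * d * L * inp.B₀ ≤ B₁')
    (hc : 0 < c) (hc₂ : 0 < c₂) (hc₃ : 0 < c₃) (hc₈ : 0 < c₈)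
    (hP3 : Prop3Body c d L C₂ inp B₀β fam)
    (hP5u : ∀ i, Prop5UniqueR c₂ c₃ (5 * d * L * inp.B₀) a (fam i).toGFData (G i))
    (hginv : ∀ i α₀ (U₀ : (fam i).Cfg) (U' : (fam i).Pert) (u : (fam i).GT),
      (fam i).InAAx α₀ U₀ U' → (fam i).InAPair α₀ U₀ ((fam i).act U' u))
    (hmono162 : ∀ i b s b' s' (U₀ : (fam i).Cfg) (U₁ : (fam i).Pert), b * s ≤ b' * s' →
      (fam i).C162 b s U₀ U₁ → (fam i).C162 b' s' U₀ U₁)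
    (hRerun : ∀ i, Rerun7074AtK c₈ B₁' a (fam i).toGFData (G i))
    (hP8 : ∀ i α₀ α₁ (U₀ : (fam i).Cfg) (U' : (fam i).Pert) (u₁ u₂ : (fam i).GT), 0 < α₀ → 0 < α₁ →
      α₀ + α₁ ≤ c₈ → (fam i).InA α₀ U₀ → (fam i).InAAx α₀ U₀ U' →
      (fam i).Restricted U₀ u₁ → (fam i).Restricted U₀ u₂ →
      (fam i).C162 B₁' (α₀ + α₁) U₀ ((fam i).act U' u₁) → (fam i).C162 B₁' (α₀ + α₁) U₀ ((fam i).act U' u₂) →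
      (G i).SmallLog c₃ ((G i).mul u₂ ((G i).inv u₁))) :
    ∃ c₁ : ℝ, 0 < c₁ ∧ Thm4UniqueBody c₁ B₁' (fun i => (fam i).toGFData) :=
  thm4Unique_of_prop5R d L C₂ B₁' inp B₀β fam G hd hL hC₂ hB₁' hc hc₂ hc₃ hc₈ hP3 hP5u hginv hmono162
    (fun i α₀ α₁ U₀ U' u₁ h0 h1 hs hA hAx hr h62 => hRerun i α₀ α₁ U₀ U' u₁ h0 h1 hs hA hAx hr h62) hP8

/-- The printed proof structure of Theorem 4 with the unprinted step as an explicit LEAF (census G-A23-1):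
`Thm4SkeletonR` whose uniqueness branch `t4u_of` consumes, besides `P5u k` (repaired Proposition 5, level k),
`P3 k` and `P8B7`, the leaf `R74 k` = the level-k re-run of (1.70)–(1.74) for the level-k solutions (the
individual Λ_k-membership Proposition 8 of [3] presupposes).  The v4 skeleton is recovered by folding `R74`
into the Prop.-8 leaf (`toSkeletonR`), which is where p. 95 keeps it.  Nothing but the shape of the induction
is asserted. [cite: Balaban1985RegularSpaces, proof of Thm 4 pp.88–95] -/
structure Thm4SkeletonL where
  T4e : ℕ → Prop
  T4u : ℕ → Prop
  Ind : ℕ → Prop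
  P5e : ℕ → Prop
  P5u : ℕ → Prop
  E110 : ℕ → Prop
  P3 : ℕ → Prop
  R74 : ℕ → Prop
  P8B7 : Prop
  base : Ind 1
  ind_of : ∀ k, 1 ≤ k → T4e k → P3 k → Ind (k + 1)
  t4e_of : ∀ k, 1 ≤ k → Ind k → P5e k → E110 k → P3 k → T4e k
  t4u_of : ∀ k, 1 ≤ k → P5u k → P3 k → R74 k → P8B7 → T4u k

/-- The v4 skeleton as the image of the refined one under "fold the re-run into the Prop.-8 leaf"
(P8B7 := P8B7 ∧ ∀ k, R74 k). [cite: Balaban1985RegularSpaces, proof of Thm 4 p.95] -/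
def Thm4SkeletonL.toSkeletonR (S : Thm4SkeletonL) : Thm4SkeletonR where
  T4e := S.T4e
  T4u := S.T4u
  Ind := S.Ind
  P5e := S.P5e
  P5u := S.P5u
  E110 := S.E110
  P3 := S.P3
  P8B7 := S.P8B7 ∧ ∀ k, S.R74 k
  base := S.base
  ind_of := S.ind_of
  t4e_of := S.t4e_of
  t4u_of := fun k hk h5 h3 h8 => S.t4u_of k hk h5 h3 (h8.2 k) h8.1

/-- Kernel: the refined induction closes — both halves of Theorem 4 at every level k ≥ 1, the uniqueness half
now fed by the named re-run leaf at its own level (routed through `Thm4SkeletonR.thm4R_all`). [cite: Balaban1985RegularSpaces, proof of Thm 4 pp.88–95] -/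
theorem Thm4SkeletonL.thm4L_all (S : Thm4SkeletonL) (hP5e : ∀ k, S.P5e k) (hP5u : ∀ k, S.P5u k)
    (hE : ∀ k, S.E110 k) (hP3 : ∀ k, S.P3 k) (hR : ∀ k, S.R74 k) (h8 : S.P8B7) :
    ∀ k, 1 ≤ k → S.T4e k ∧ S.T4u k :=
  S.toSkeletonR.thm4R_all hP5e hP5u hE hP3 ⟨h8, hR⟩

/-- Kernel: the uniqueness half at level k consumes `P5u k`, `P3 k`, the re-run `R74 k` AT LEVEL k ONLY and
Proposition 8 of [3] — no inductive input and no re-run at other levels. [cite: Balaban1985RegularSpaces, proof of Thm 4 p.95] -/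
theorem Thm4SkeletonL.t4u_at (S : Thm4SkeletonL) (k : ℕ) (hk : 1 ≤ k) (hP5u : S.P5u k) (hP3 : S.P3 k)
    (hR : S.R74 k) (h8 : S.P8B7) : S.T4u k :=
  S.t4u_of k hk hP5u hP3 hR h8

/-! ### (iv) Arithmetic of Sect. F and the constant of (1.37) -/

/-- Census G-B8-14 (kernel): the last step of (1.130), p. 98, "11d²L²α₀ + 5dL²Mα₀ < 6dL²Mα₀", holds iff M > 11d
(d, L, α₀ > 0) — a size condition on M that the text does not state (harmless: M ≥ R₁M₁ is "sufficiently large";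
otherwise replace 6 by 16d, constants only). [cite: Balaban1985RegularSpaces, (1.130) p.98] -/
theorem ineq130_iff {d L M α₀ : ℝ} (hd : 0 < d) (hL : 0 < L) (hα : 0 < α₀) :
    11 * d ^ 2 * L ^ 2 * α₀ + 5 * d * L ^ 2 * M * α₀ < 6 * d * L ^ 2 * M * α₀ ↔ 11 * d < M := by
  have h : 0 < d * L ^ 2 * α₀ := by positivity
  constructor
  · intro H
    by_contra hc
    have hc' : M ≤ 11 * d := not_lt.mp hc
    nlinarith [mul_le_mul_of_nonneg_right hc' h.le]
  · intro H
    nlinarith [mul_lt_mul_of_pos_right H h]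

/-- Kernel (p. 99, the application of Theorem 4 inside the proof of Prop. 6; r1 census): with "α₀" = L³α₀ from
(1.132) and "α₁" = 6dL²Mα₀ from (1.133)–(1.134), the smallness parameter L³α₀ + 6dL²Mα₀ is ≤ 7dL²Mα₀ — the
quantity in the hypothesis 7dL²Mα₀ ≤ c₁ and in (1.136) — iff L ≤ dM (true since M ≥ L). [cite: Balaban1985RegularSpaces, (1.132)–(1.136) p.99] -/
theorem prop6_smallness_iff {d L M α₀ : ℝ} (hL : 0 < L) (hα : 0 < α₀) :
    L ^ 3 * α₀ + 6 * d * L ^ 2 * M * α₀ ≤ 7 * d * L ^ 2 * M * α₀ ↔ L ≤ d * M := by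
  have h : 0 < L ^ 2 * α₀ := by positivity
  constructor
  · intro H
    by_contra hc
    have hc' : d * M < L := not_le.mp hc
    nlinarith [mul_lt_mul_of_pos_right hc' h]
  · intro H
    nlinarith [mul_le_mul_of_nonneg_right H h.le]

/-- Census G-B8-15 (kernel; pp. 98–99): the collar margin in the construction of Sect. F.  With the scale
L^kη = 1, dist(∂□₀, □) = Σ_{j=0}^{k} R₁M₁L^{j}η = R₁M₁ Σ_{i=0}^{k} L^{−i} and dist(∂□̃, □) = 2R₁M₁ (p. 98); since
Σ_{i=0}^{k} L^{−i} ≤ 2 − L^{−k} for L ≥ 2 (this lemma), dist(∂□̃, □₀) ≥ R₁M₁L^{−k} = R₁M₁η ≥ 2η once R₁M₁ ≥ 2, so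
the plaquettes of U₀″ straddling ∂□̃ (where U₀″ jumps from U₀′ to 1) lie outside □₀ and are not constrained by
𝔄_k({□_j}, L³α₀) in (1.132) ((1.7)–(1.9) p. 77 constrain only plaquettes/bonds with an end-point in □_j). [cite: Balaban1985RegularSpaces, (1.131)–(1.133) pp.98–99] -/
theorem sectF_collar_margin {L : ℝ} (hL : 2 ≤ L) :
    ∀ k : ℕ, ∑ i ∈ Finset.range (k + 1), (1 / L) ^ i ≤ 2 - (1 / L) ^ k := by
  intro k
  induction k with
  | zero => norm_num
  | succ n ih =>
    rw [Finset.sum_range_succ]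
    have hq : (1 / L) ^ (n + 1) = (1 / L) ^ n * (1 / L) := pow_succ _ _
    have hpos : 0 ≤ (1 / L) ^ n := by positivity
    have hL0 : 0 < L := by linarith
    have h2 : 2 * (1 / L) ≤ 1 := by
      rw [mul_one_div, div_le_one hL0]; exact hL
    nlinarith [mul_le_mul_of_nonneg_left h2 hpos]

/-- Sub-cell second engine for the constant of (1.37) (p. 82; p. 83: "(1.37) is basically of an algebraic
character"): B is (1/i) log of a product of at most d(L − 1) + 1 unitary factors each within α₁ of its
unperturbed value ((1.35), (1.29)–(1.31)), and |log V| ≤ (π/2)|V − 1| on the unitary group, so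
|B| ≤ (π/2)(d(L − 1) + 1)α₁ (to first order); this is < 2dLα₁ for d ≥ 1, L ≥ 1 since π < 4. [folklore] -/
theorem ineq137 {d L α₁ : ℝ} (hd : 1 ≤ d) (hL : 1 ≤ L) (hα : 0 < α₁) :
    Real.pi / 2 * (d * (L - 1) + 1) * α₁ < 2 * d * L * α₁ := by
  have hπ : Real.pi < 4 := by linarith [Real.pi_lt_d2]
  have h1 : d * (L - 1) + 1 ≤ d * L := by nlinarith
  have h2 : 0 < d * (L - 1) + 1 := by nlinarith
  nlinarith [mul_pos (sub_pos.2 hπ) (mul_pos h2 hα), mul_nonneg (sub_nonneg.2 h1) hα.le, Real.pi_pos]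

/-! ### (v) Algebraic identities (second engine): (1.49)–(1.50) and the projection R of Sect. D -/

/-- Census C-B8-10 (kernel, second engine for (1.49) p. 85): in any ring the second-order term of a product of four
exponentials, V₂ = Σᵢxᵢ² + 2Σ_{i<j}xᵢxⱼ, equals (Σᵢxᵢ)² plus the six commutators Σ_{i<j}[xᵢ, xⱼ] — the printed
"V₂(U₀, A, ∂p) = η²((D^η_{U₀}A)(p))² + {…}" once Σᵢxᵢ = η(D^η_{U₀}A)(p) (`commutators_150`). [cite: Balaban1985RegularSpaces, (1.49) p.85] -/
theorem v2_identity {R : Type*} [Ring R] (a b c e : R) :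
    a * a + b * b + c * c + e * e + 2 * (a * b + a * c + a * e + b * c + b * e + c * e) =
      (a + b + c + e) * (a + b + c + e) +
        ((a * b - b * a) + (a * c - c * a) + (a * e - e * a) + (b * c - c * b) + (b * e - e * b) +
          (c * e - e * c)) := by
  noncomm_ring

/-- Census C-B8-10 (kernel, second engine for (1.50) p. 85): with the plaquette dictionary x₁ = A_μ(x),
x₂ = R(U₀(x, x+ηe_μ))A_ν(x+ηe_μ) = A_ν + P, x₃ = −R(…)A_μ(x+ηe_ν) = −(A_μ + Q), x₄ = −A_ν, where P = η(D_μA_ν)(x),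
Q = η(D_νA_μ)(x): x₁ + x₂ + x₃ + x₄ = P − Q = η(D^η_{U₀}A)(p_{μν}(x)), and the six commutators sum to the printed
2[A_μ, A_ν] + 2η[A_μ, D_μA_ν] + 2η[D_νA_μ, A_ν] − η[A_μ, D_νA_μ] − η[D_μA_ν, A_ν] − η²[D_μA_ν, D_νA_μ]
(every η absorbed into P, Q). [cite: Balaban1985RegularSpaces, (1.50) p.85] -/
theorem commutators_150 {R : Type*} [Ring R] (Aμ Aν P Q : R) :
    (Aμ + (Aν + P) + -(Aμ + Q) + -Aν = P - Q) ∧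
    ((Aμ * (Aν + P) - (Aν + P) * Aμ) + (Aμ * -(Aμ + Q) - -(Aμ + Q) * Aμ) + (Aμ * -Aν - -Aν * Aμ) +
        ((Aν + P) * -(Aμ + Q) - -(Aμ + Q) * (Aν + P)) + ((Aν + P) * -Aν - -Aν * (Aν + P)) +
        (-(Aμ + Q) * -Aν - -Aν * -(Aμ + Q)) =
      2 * (Aμ * Aν - Aν * Aμ) + 2 * (Aμ * P - P * Aμ) + 2 * (Q * Aν - Aν * Q) - (Aμ * Q - Q * Aμ) -
        (P * Aν - Aν * P) - (P * Q - Q * P)) := by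
  constructor
  · abel
  · noncomm_ring

/-- Census C-B8-11 (kernel; p. 92–93, the algebra behind (1.93)–(1.95)): in any ring, if G′ is a right inverse
of Δ + Q′*aQ′ ((Δ + Q′*aQ′)G′ = 1, G′ = (Δ′_a)^{−1} of (1.91)) and C a right inverse of Q′G′²Q′*
(C = (Q′G′²Q′*)^{−1}), then R = 1 − G′Q′*CQ′G′ (the projection of (3.25) of [4], p. 92) satisfies:
Q′G′R = 0 — so λ = G′Rg obeys the linearised restriction Q′λ = 0 of (1.29)/(1.86); R² = R; and ΔG′R = R — so
Δλ = Rg and RΔλ = Rg, the linear equation (1.93) solved by (1.94)–(1.95). [cite: Balaban1985RegularSpaces, (1.93)–(1.95) pp.92–93] -/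
theorem landau_projection_identities {A : Type*} [Ring A] (Δ Qp Qs a Gp C : A)
    (hG : (Δ + Qs * a * Qp) * Gp = 1) (hC : Qp * Gp * Gp * Qs * C = 1) :
    Qp * Gp * (1 - Gp * Qs * C * Qp * Gp) = 0 ∧
    (1 - Gp * Qs * C * Qp * Gp) * (1 - Gp * Qs * C * Qp * Gp) = 1 - Gp * Qs * C * Qp * Gp ∧
    Δ * Gp * (1 - Gp * Qs * C * Qp * Gp) = 1 - Gp * Qs * C * Qp * Gp := by
  have h1 : Qp * Gp * (1 - Gp * Qs * C * Qp * Gp) = 0 := by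
    have e : Qp * Gp * (Gp * Qs * C * Qp * Gp) = (Qp * Gp * Gp * Qs * C) * (Qp * Gp) := by noncomm_ring
    rw [mul_sub, mul_one, e, hC, one_mul, sub_self]
  refine ⟨h1, ?_, ?_⟩
  · have e : (1 - Gp * Qs * C * Qp * Gp) * (1 - Gp * Qs * C * Qp * Gp) =
        1 - Gp * Qs * C * Qp * Gp - Gp * Qs * C * Qp * Gp +
          Gp * Qs * C * (Qp * Gp * Gp * Qs * C) * (Qp * Gp) := by noncomm_ring
    rw [e, hC]; noncomm_ring
  · have hΔ : Δ * Gp = 1 - Qs * a * Qp * Gp := by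
      rw [eq_sub_iff_add_eq, ← hG]; noncomm_ring
    have e : Δ * Gp * (1 - Gp * Qs * C * Qp * Gp) =
        (1 - Gp * Qs * C * Qp * Gp) - Qs * a * (Qp * Gp * (1 - Gp * Qs * C * Qp * Gp)) := by
      rw [hΔ]; noncomm_ring
    rw [e, h1, mul_zero, sub_zero]

/-! ### (vi) Theorem 8 — the sub-cell's inspection (GAPS G-B8-13) -/

/-- Sub-cell B08 INSPECTION of Theorem 8.  The printed proof is the passage p. 100 l. −1 – p. 101 l. 9 [PDF
26–27], verbatim: *"It is written with 0 on the right-hand side, but nothing prevents us to consider a more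
general condition of the form R(U₀)D^{η*}_{U₀}A = f, (1.146) where f is a function from the space R(U₀), i.e. a
Lie algebra valued function defined on Ω₀ and satisfying R(U₀)f = f. Of course we have to assume that f is in a
sufficiently small neighborhood of 0, for example it is enough to assume that |f|_{(−2)} < γ(α₀ + α₁) with a
positive, not too big, constant γ, e.g. γ = 1. Inspecting the proofs of the theorems and propositions we can see
easily that they work in this more general situation almost without any changes, only some constants change their
numerical values. Thus we have the following generalization of Theorem 2."*  (Revision v3, cell GAPS G-pv17-2:
an earlier version of this docstring gave a paraphrase of this passage inside quotation marks; docstring-only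
correction, the typed body is unchanged.)  Running the inspection: with R D^{η*}A = f in place of the first equation of (1.42), (1.57)–(1.58) become
A = G(U₀)J′ + G(U₀)Σ_jQ*_jΛ_j(L^jη)^{−3}B₁ + G(U₀)D^η_{U₀}f, and Theorem 3.1/3.3 of [4] bound the new term by its
(3.42)–(3.47) entries for G∇*: |G∇*f|₍₋₁₎ ≤ B₀|f|₍₋₂₎ (fine), but sup|∇G∇*f| only through (3.44) with a Hölder
norm ‖f‖_ε, B′₀(ε) → ∞ as ε → 0, and the Hölder norm of ∇G∇*f only through (3.45) with ‖f‖_{β+ε}.  Hence for f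
with only |f|₍₋₂₎ < γ(α₀ + α₁) (the printed hypothesis) the clauses |∇^η_{U₀}A| < B₁(α₀ + α₁)(L^jη)^{−2} and
‖A‖_{1,β} < B₂(β₀)(α₀ + α₁)(L^jη)^{−2−β} of (1.36) are NOT delivered, and cannot be with k-uniform constants:
model U₀ = 1, f = Δλ₀ (λ₀ ∈ N(Q′)) gives ∇A ⊇ Hess Δ^{−1}f, and sup|∂₁∂₂Δ^{−1}f|/sup|f| = 1.18, 1.60, 2.03, 2.47,
2.91, 3.35 at N = 16, …, 512 lattice points per side (increment (2/π)ln 2 per doubling; cell numerics N-B8-4,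
job j038525).  Typed here is what the inspection DOES deliver: a restricted u with (1.146), (1.37) and the
|A|-clause of (1.36) ((1.62)-shape), unique among restricted u′ with these properties (the uniqueness mechanism
(1.112)/Prop. 5 uses only |λ|, |Dλ|₍₋₁₎), and the full (1.36) + (1.39) under the ADDED hypothesis
|D^η_{U₀}f|₍₋₃₎ < γ(α₀ + α₁) (`fGrad`; alternatively a scaled ε-Hölder bound on f, constants then depending on
ε).  ((1.39) without the added hypothesis is plausible by a reorganised argument — one Prop-5-type step with
source around the Theorem-2 solution — which the paper does not print; not typed.)  This is the sub-cell's
reading (GAPS G-B8-13), NOT a statement of the paper; B10's use of Theorem 8 must be checked against it. [cite: Balaban1985RegularSpaces, Thm 8 (1.146) p.101] -/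
def Thm8Inspected (B₁ B₁' B₂ : ℝ) (fam : I → GFData2) : Prop :=
  ∀ γ : ℝ, 0 < γ → ∃ c₁ : ℝ, 0 < c₁ ∧
    ∀ i : I, ∀ α₀ α₁ : ℝ, 0 < α₀ → 0 < α₁ → α₀ + α₁ ≤ c₁ →
      ∀ U₀ : (fam i).Cfg, ∀ U' : (fam i).Pert, ∀ f : (fam i).Src,
        (fam i).InA α₀ U₀ → (fam i).Reg335 α₀ U₀ → (fam i).InAAx α₀ U₀ U' → (fam i).avgClose α₁ U₀ U' →
        (fam i).fNorm f < γ * (α₀ + α₁) →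
          ∃ u : (fam i).GT, (fam i).Restricted U₀ u ∧
            (fam i).C162 B₁ (α₀ + α₁) U₀ ((fam i).act U' u) ∧ (fam i).C137 α₁ U₀ ((fam i).act U' u) ∧
            (fam i).LandauF U₀ f ((fam i).act U' u) ∧
            ((fam i).fGrad U₀ f < γ * (α₀ + α₁) →
              (fam i).C136 B₁ B₂ (α₀ + α₁) U₀ ((fam i).act U' u) ∧ (fam i).C139 B₁ (α₀ + α₁) U₀ ((fam i).act U' u)) ∧
            ∀ u' : (fam i).GT, (fam i).Restricted U₀ u' →
              (fam i).C162 B₁' (α₀ + α₁) U₀ ((fam i).act U' u') → (fam i).C137 α₁ U₀ ((fam i).act U' u') →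
              (fam i).LandauF U₀ f ((fam i).act U' u') → u' = u

/-- Kernel: the existence-with-bounds half of the printed Theorem 8 implies the existence half of the inspected
form WITHOUT the uniqueness clause and with the ∇/Hölder clauses kept only under the added hypothesis — i.e. the
inspected form asks less of existence; its uniqueness clause (fewer conditions on u′) is the part that is NOT a
formal consequence of `Thm8Printed`. (`h136_162` = (1.62) is the first clause of (1.36).) [folklore] -/
theorem thm8_exists_of_printed (B₁ B₂ : ℝ) (fam : I → GFData2)
    (h8 : Thm8Printed B₁ B₂ (fun i => (fam i).toGFData))
    (h136_162 : ∀ i b b₂ s (U₀ : (fam i).Cfg) (U₁ : (fam i).Pert),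
      (fam i).C136 b b₂ s U₀ U₁ → (fam i).C162 b s U₀ U₁) :
    ∀ γ : ℝ, 0 < γ → ∃ c₁ : ℝ, 0 < c₁ ∧
      ∀ i : I, ∀ α₀ α₁ : ℝ, 0 < α₀ → 0 < α₁ → α₀ + α₁ ≤ c₁ →
        ∀ U₀ : (fam i).Cfg, ∀ U' : (fam i).Pert, ∀ f : (fam i).Src,
          (fam i).InA α₀ U₀ → (fam i).Reg335 α₀ U₀ → (fam i).InAAx α₀ U₀ U' → (fam i).avgClose α₁ U₀ U' →
          (fam i).fNorm f < γ * (α₀ + α₁) →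
            ∃ u : (fam i).GT, (fam i).Restricted U₀ u ∧
              (fam i).C162 B₁ (α₀ + α₁) U₀ ((fam i).act U' u) ∧ (fam i).C137 α₁ U₀ ((fam i).act U' u) ∧
              (fam i).LandauF U₀ f ((fam i).act U' u) ∧
              ((fam i).fGrad U₀ f < γ * (α₀ + α₁) →
                (fam i).C136 B₁ B₂ (α₀ + α₁) U₀ ((fam i).act U' u) ∧
                (fam i).C139 B₁ (α₀ + α₁) U₀ ((fam i).act U' u)) := by
  intro γ hγ
  obtain ⟨c₁, hc₁, H⟩ := h8 γ hγ
  refine ⟨c₁, hc₁, fun i α₀ α₁ h0 h1 hs U₀ U' f hA hReg hAx hcl hf => ?_⟩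
  obtain ⟨u, hu, ⟨h36, h37, h39, h146⟩, _⟩ := H i α₀ α₁ h0 h1 hs U₀ U' f hA hReg hAx hcl hf
  exact ⟨u, hu, h136_162 i _ _ _ U₀ _ h36, h37, h146, fun _ => ⟨h36, h39⟩⟩

/-! ### (vii) The B8 leaf -/

/-- The B8 block of `…Dag.Leaves.b8` for one choice of constants and carriers: the printed statements of the
paper bundled — Lemma 1 (p. 79), Theorem 2 (p. 83), Proposition 3 (p. 87), Theorem 4 (p. 88), Proposition 5
(p. 94, existence and uniqueness halves), Proposition 6 (p. 99), Proposition 7 (p. 100), Theorem 8 (p. 101).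
A binding `b8 := B8.Concl …` is the cell's refinement target (LEMMAS.md P08).  Deliberately absent: (1.147)
(printed as unproved, G-B8-09).  Inside the bundle `t2` is REDUNDANT given `t4`, `p3` and the bookkeeping facts
of `thm2_of_thm4_prop3` (p. 88).
SUPERSEDED as the DAG's B8 leaf (v3.1 note, REFEREE R22.1 / GAPS G-ref1-8): the fields `p7 : Prop7Printed` and
`t8 : Thm8Printed` bundled here are the r1 TYPED forms, which are STRONGER than print (two of the three members of
(1.140) p. 100 and the membership "f from the space R(U₀)" p. 101 are dropped; `Thm8Printed` quantifies over all γ).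
The faithful leaf is `DagBinding.B8LeafR` with `p7 := B8SectGH.Prop7PrintedR`, `t8 := B8SectGH.Thm8PrintedAt 1`,
bound by `DagBinding.Upstream.ofPrintedR` / `Upstream.ofPrintedFull` (THE binding for end statements); the direction
old ⇒ faithful is kernel-checked (`B8SectGH.prop7PrintedR_of_printed`, `B8SectGH.thm8PrintedR_of_printed`,
`DagBinding.b8LeafR_of_concl`), the converse is not claimed.  `Concl` is kept because `Upstream.ofPrinted` and its
importers still elaborate against it. [cite: Balaban1985RegularSpaces, Lemma 1 – Thm 8 pp.79–101] -/
structure Concl {I₁ I₂ I₃ I₄ : Type} (d : ℕ) (L C₂ B₁' B₀' B₁ B₂ c₁ : ℝ) (inp : B9Inputs) (B₀β : ℝ)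
    (loc : I₁ → LocalData) (fam : I₂ → GFData2) (lan : I₃ → LandauData) (cub : I₄ → CubeData)
    (toAxial : ∀ i, (fam i).Cfg → (fam i).Pert → (fam i).Pert) : Prop where
  l1 : Lemma1Printed d loc
  t2 : Thm2Printed (fun i => (fam i).toGFData)
  p3 : Prop3Printed d L C₂ inp B₀β fam
  t4 : Thm4Printed B₁' (fun i => (fam i).toGFData)
  p5e : Prop5Exists B₀' B₁ lan
  p5u : Prop5Unique lan
  p6 : Prop6Printed d L B₁ c₁ cub
  p7 : Prop7Printed (fun i => (fam i).toGFData) toAxial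
  t8 : Thm8Printed B₁ B₂ (fun i => (fam i).toGFData)

end Literature.MathematicalPhysics.QuantumFieldTheory.Balaban1983to89.B8
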